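import Literature.Geometry.Lorentzian.KerrRedShiftFlux
import Literature.Geometry.Lorentzian.KerrHorizonRegularWaveBoundednessProofs
import Literature.Geometry.Lorentzian.KerrEnergyFromLocalEnergy
import HarnessLib

/-!
# The red-shift estimate near the Kerr horizon between admissible graph leaves
# (Dafermos–Rodnianski–Shlapentokh-Rothman, Prop. 4.5.2, in the form used in §13.2) — preparations

(family `gr`; namespaces `Literature.Geometry.Lorentzian.KerrSchild`, `…E4`, `…Kerr`; written from the
proving seat of the named fact
`Literature.Geometry.Lorentzian.DafermosRodnianskiShlapentokhRothman2016_energyBoundedness_horizonRegular`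
(`KerrHorizonRegularWaveBoundedness.lean`). Fourth step of the near-horizon ingredient of DRSR
arXiv:1402.7034, §13.2, after `KerrRedShiftCoercivity.lean`, `KerrRedShiftTimelike.lean`,
`KerrRedShiftFlux.lean`. No named fact is introduced (D-0026); everything is proved.)

The red-shift estimate (DRSR Prop. 4.5.2, from [dr7]; Dafermos–Rodnianski arXiv:0811.0354, §3.3.3)
integrates the current of the red-shift multiplier `N`, cut off to a collar of the horizon, over
the region between two leaves: the bulk has a good sign on the collar (Prop. 4.5.1), the boundary
terms through the leaves and through `𝓗⁺` have signs (dominant energy condition), and the cut-off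
error lives in a shell away from the horizon. This file supplies the preparations of that argument
in the Kerr–Schild chart:

* `KerrSchild.multiplierBulk_congr_of_eventuallyEq`, `Kerr.multiplierBulk_surgeryBackground_eq` —
  the bulk is local in the coefficients, so the coercivity of `KerrRedShiftCoercivity.lean` (stated
  for `g_{M,a}⁻¹`) applies to the surgered background `Kerr.surgeryBackground M a r₊` of the energy
  identities at exterior points;
* `Kerr.contDiffAt_redShiftCurrent`, `Kerr.sum_fderiv_redShiftCurrent` — the red-shift current
  `(J^N)^μ[Φ]` is `C¹` at points with `r > 0` where `Φ ∈ C²`, and for solutions its divergence at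
  exterior points is the bulk `K^N[Φ]` (`KerrSchild.sum_fderiv_multiplierCurrent`);
* `Kerr.collarCutoff` — the radial cut-off to the collar `χ = σ((R₂ − r)/(R₂ − R₁))` (`σ = Real.smoothTransition`):
  smooth on `ℝ⁴`, `t*`-invariant, `= 1` on `{r ≤ R₁}`, `= 0` on `{r ≥ R₂}`, with differential
  supported in the shell `{R₁ ≤ r ≤ R₂}` and bounded (`exists_abs_fderiv_collarCutoff_le`);
* `Kerr.redShiftWeight` — the weight `W_ε = χ · σ(u₂/ε − 1)` (radial cut-off times the receding
  horizon factor of `KerrDomainOfDependence.lean`), its support set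
  `Kerr.redShiftWeightSet = {ε ≤ u₂} ∩ {r ≤ R₂}` (closed, inside the exterior, spatially bounded);
* `E4.graphFlux_add_integral_le_of_divergence_le` (**the energy inequality along a graph foliation
  for a current with signed divergence**): if a `C¹` current `J` vanishes off a closed set whose
  slab points are spatially bounded and `∑ ∂_μ J^μ ≤ −ℓ + e` there (`ℓ, e` continuous, `ℓ = 0` off
  the set, `e ≥ 0`), then `f(s) + ∫_0^s ∫ ℓ ≤ f(0) + ∫_0^s ∫ e` for the fluxes `f(t)` through the
  leaves `{x⁰ = t + F(x⃗)}` (from `E4.graphFlux_sub_eq_integral_divergence`); this is the shape of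
  (ingeneralform2) of DRSR §2.3.2 with a bulk of good sign and a localised error.

## References

* M. Dafermos, I. Rodnianski, Y. Shlapentokh-Rothman, Ann. of Math. 183 (2016), arXiv:1402.7034:
  §2.3.2, §4.5 Prop. 4.5.2, §13.2 (key `DafermosRodnianskiShlapentokhrothman2014`).
* M. Dafermos, I. Rodnianski, arXiv:0811.0354, §3.3.2–§3.3.3, Thm. 7.1, App. D
  (key `DafermosRodnianski2008`).
-/

noncomputable section

open Set Filter Metric MeasureTheory
open scoped Topology ENNReal

namespace Literature.Geometry.Lorentzian

/-! ## Part 1. Locality of the bulk; the red-shift current at exterior points -/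

namespace KerrSchild

/-- **The bulk is local in the coefficients**: if `G` and `G'` agree near `x` then `K^X` computed
with `G` and with `G'` agree at `x` (the bulk involves `G(x)` and `∂G(x)` only). [folklore] -/
theorem multiplierBulk_congr_of_eventuallyEq {G G' : E4 → Fin 4 → Fin 4 → ℝ} {x : E4}
    (h : ∀ μ ν, (fun y ↦ G y μ ν) =ᶠ[𝓝 x] fun y ↦ G' y μ ν) (X : E4 → Fin 4 → ℝ) (w : E4 → ℝ) :
    multiplierBulk G X w x = multiplierBulk G' X w x := by
  have h0 : ∀ μ ν, G x μ ν = G' x μ ν := fun μ ν ↦ (h μ ν).self_of_nhds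
  have h1 : ∀ α β, fderiv ℝ (fun y ↦ G y α β) x = fderiv ℝ (fun y ↦ G' y α β) x :=
    fun α β ↦ (h α β).fderiv_eq
  simp only [multiplierBulk, h0, h1]

end KerrSchild

namespace Kerr

variable {M a : ℝ} {x : E4}

/-- On the exterior the bulk of any multiplier computed with the surgered background
`Kerr.surgeryBackground M a r₊` is the bulk computed with `g_{M,a}⁻¹`. [cite: KerrSchild1965, §2] -/
theorem multiplierBulk_surgeryBackground_eq (hMa : IsSubextremal M a) (hx : rPlus M a < radius a x)
    (X : E4 → Fin 4 → ℝ) (w : E4 → ℝ) :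
    KerrSchild.multiplierBulk (surgeryBackground M a (rPlus M a) hMa.pos.le hMa.rPlus_pos).inverseMetric
        X w x = KerrSchild.multiplierBulk (inverseMetric M a) X w x := by
  refine (KerrSchild.multiplierBulk_congr_of_eventuallyEq (fun μ ν ↦ ?_) X w).symm
  have h := surgeryBackground_inverseMetric_eventuallyEq M a hMa.pos.le hMa.rPlus_pos
    ⟨x, mem_region.2 (max_lt hx (hMa.rPlus_pos.trans hx))⟩ μ ν
  have h' : (fun y ↦ inverseMetric M a y μ ν) =
      fun y ↦ KerrSchild.inverseMetric (fun z ↦ 2 * scalarH M a z) (nullVector a) y μ ν :=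
    funext fun y ↦ inverseMetric_eq_kerrSchild M a y μ ν
  rw [h']
  exact h

/-- **The red-shift current is `C¹` at points with `r > 0` where `Φ ∈ C²`** (the coefficients of
the surgered background are `C¹`, the components of `N` are smooth where `r > 0`). [folklore] -/
theorem contDiffAt_redShiftCurrent (hMa : IsSubextremal M a) (h₁ f₁ : ℝ) {Φ : E4 → ℝ}
    (hΦ : ContDiffAt ℝ 2 Φ x) (hx : 0 < radius a x) (μ : Fin 4) :
    ContDiffAt ℝ 1 (fun y ↦ KerrSchild.multiplierCurrent
      (surgeryBackground M a (rPlus M a) hMa.pos.le hMa.rPlus_pos).inverseMetric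
      (redShiftVector M a h₁ f₁) Φ y μ) x := by
  set B := surgeryBackground M a (rPlus M a) hMa.pos.le hMa.rPlus_pos with hB
  have h2 : ContDiffAt ℝ ((1 : ℕ∞) + 1 : ℕ∞) Φ x := by exact_mod_cast hΦ
  have hp : ∀ ν, ContDiffAt ℝ 1 (fun y ↦ fderiv ℝ Φ y (E4.basisVector ν)) x := fun ν ↦
    (h2.fderiv_right (m := 1) le_rfl).clm_apply contDiffAt_const
  have hg : ∀ α β, ContDiffAt ℝ 1 (fun y ↦ B.inverseMetric y α β) x := fun α β ↦
    (B.contDiff_one_inverseMetric α β).contDiffAt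
  have hX : ∀ α, ContDiffAt ℝ 1 (fun y ↦ redShiftVector M a h₁ f₁ y α) x := fun α ↦
    contDiffAt_redShiftVector_apply M a h₁ f₁ hx α
  unfold KerrSchild.multiplierCurrent
  exact ((ContDiffAt.sum fun ν _ ↦ (hg μ ν).mul (hp ν)).mul
    (ContDiffAt.sum fun α _ ↦ (hX α).mul (hp α))).sub
    ((contDiffAt_const.mul (hX μ)).mul
      (ContDiffAt.sum fun α _ ↦ ContDiffAt.sum fun β _ ↦ ((hg α β).mul (hp α)).mul (hp β)))

/-- **The divergence of the red-shift current of a solution is the bulk**: at an exterior point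
where `□_B Φ = 0`, `∑_μ ∂_μ (J^N)^μ = K^N[Φ]` (`KerrSchild.sum_fderiv_multiplierCurrent`), the bulk
being computed with `g_{M,a}⁻¹`. [cite: DafermosRodnianskiShlapentokhrothman2014, §2.3.2] -/
theorem sum_fderiv_redShiftCurrent (hMa : IsSubextremal M a) (h₁ f₁ : ℝ) {Φ : E4 → ℝ}
    (hΦ : ContDiffAt ℝ 2 Φ x) (hx : rPlus M a < radius a x)
    (hsol : KerrSchild.waveOperator
      (surgeryBackground M a (rPlus M a) hMa.pos.le hMa.rPlus_pos).inverseMetric Φ x = 0) :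
    ∑ μ, fderiv ℝ (fun y ↦ KerrSchild.multiplierCurrent
      (surgeryBackground M a (rPlus M a) hMa.pos.le hMa.rPlus_pos).inverseMetric
      (redShiftVector M a h₁ f₁) Φ y μ) x (E4.basisVector μ) =
      KerrSchild.multiplierBulk (inverseMetric M a) (redShiftVector M a h₁ f₁) Φ x := by
  set B := surgeryBackground M a (rPlus M a) hMa.pos.le hMa.rPlus_pos with hB
  have hxpos : 0 < radius a x := hMa.rPlus_pos.trans hx
  have h := KerrSchild.sum_fderiv_multiplierCurrent (B.differentiableAt_inverseMetric x)
    (B.inverseMetric_symm x)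
    (fun α ↦ (contDiffAt_redShiftVector_apply M a h₁ f₁ hxpos α (n := 1)).differentiableAt
      one_ne_zero) hΦ
  rw [hsol, zero_mul, zero_add] at h
  rw [h, hB, multiplierBulk_surgeryBackground_eq hMa hx]

/-! ## Part 2. The radial cut-off to a collar -/

/-- **The radial cut-off** `χ(x) = σ((R₂ − r(x))/(R₂ − R₁))` (`σ = Real.smoothTransition`): equal to
`1` on `{r ≤ R₁}`, to `0` on `{r ≥ R₂}`, with values in `[0, 1]`, `t*`-invariant, smooth on `ℝ⁴`
for `0 < R₁ < R₂` (DRSR §13.2: "a cutoff which is identically `1` on … and identically `0`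
on …"). [cite: DafermosRodnianskiShlapentokhrothman2014, §13.2] -/
def collarCutoff (a R₁ R₂ : ℝ) (x : E4) : ℝ :=
  Real.smoothTransition ((R₂ - radius a x) / (R₂ - R₁))

/-- `0 ≤ χ`. [folklore] -/
theorem collarCutoff_nonneg (a R₁ R₂ : ℝ) (x : E4) : 0 ≤ collarCutoff a R₁ R₂ x :=
  Real.smoothTransition.nonneg _

/-- `χ ≤ 1`. [folklore] -/
theorem collarCutoff_le_one (a R₁ R₂ : ℝ) (x : E4) : collarCutoff a R₁ R₂ x ≤ 1 :=
  Real.smoothTransition.le_one _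

/-- `χ = 1` on `{r ≤ R₁}` (`R₁ < R₂`). [folklore] -/
theorem collarCutoff_eq_one {a R₁ R₂ : ℝ} (hR : R₁ < R₂) (hx : radius a x ≤ R₁) :
    collarCutoff a R₁ R₂ x = 1 := by
  refine Real.smoothTransition.one_of_one_le ?_
  rw [le_div_iff₀ (sub_pos.mpr hR)]
  linarith

/-- `χ = 0` on `{r ≥ R₂}` (`R₁ < R₂`). [folklore] -/
theorem collarCutoff_eq_zero {a R₁ R₂ : ℝ} (hR : R₁ < R₂) (hx : R₂ ≤ radius a x) :
    collarCutoff a R₁ R₂ x = 0 := by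
  refine Real.smoothTransition.zero_of_nonpos ?_
  exact div_nonpos_iff.mpr (Or.inr ⟨by linarith, (sub_pos.mpr hR).le⟩)

/-- Where `χ ≠ 0`, `r < R₂`. [folklore] -/
theorem radius_lt_of_collarCutoff_ne_zero {a R₁ R₂ : ℝ} (hR : R₁ < R₂)
    (hx : collarCutoff a R₁ R₂ x ≠ 0) : radius a x < R₂ := by
  by_contra h
  exact hx (collarCutoff_eq_zero hR (not_lt.mp h))

/-- `χ` is `t*`-invariant. [folklore] -/
theorem collarCutoff_add_smul_basisVector_zero (a R₁ R₂ : ℝ) (x : E4) (t : ℝ) :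
    collarCutoff a R₁ R₂ (x + t • E4.basisVector 0) = collarCutoff a R₁ R₂ x := by
  simp only [collarCutoff, radius_add_time_smul_basisVector]

/-- **`χ` is smooth on `ℝ⁴`** (`0 < R₁ < R₂`): `1 − χ` vanishes on `{r < R₁}`, a neighbourhood of
the non-smooth locus `{r = 0}` of the radius, and is a smooth composite where `r > R₁/2`.
[folklore] -/
theorem contDiff_collarCutoff {a R₁ R₂ : ℝ} (hR₁ : 0 < R₁) (hR : R₁ < R₂) {n : ℕ∞} :
    ContDiff ℝ n (collarCutoff a R₁ R₂) := by
  have h : ContDiff ℝ n fun x ↦ 1 - collarCutoff a R₁ R₂ x := by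
    refine contDiff_of_eq_zero_of_radius_lt (a := a) (c := R₁) hR₁ (fun x hx ↦ ?_) (fun x hx ↦ ?_)
    · rw [collarCutoff_eq_one hR hx.le, sub_self]
    · have hpos : 0 < radius a x := lt_trans (by positivity) hx
      exact contDiffAt_const.sub (Real.smoothTransition.contDiff.contDiffAt.comp x
        ((contDiffAt_const.sub (contDiffAt_radius hpos)).div_const _))
  have : collarCutoff a R₁ R₂ = fun x ↦ 1 - (1 - collarCutoff a R₁ R₂ x) := by
    funext x; ring
  rw [this]
  exact contDiff_const.sub h

/-- The differential of `χ` vanishes off the shell `{R₁ ≤ r ≤ R₂}` (`χ` is locally constant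
there). [folklore] -/
theorem fderiv_collarCutoff_eq_zero {a R₁ R₂ : ℝ} (hR : R₁ < R₂)
    (hx : radius a x < R₁ ∨ R₂ < radius a x) : fderiv ℝ (collarCutoff a R₁ R₂) x = 0 := by
  rcases hx with hx | hx
  · have hev : ∀ᶠ y in 𝓝 x, radius a y < R₁ :=
      (continuous_radius a).continuousAt.eventually_lt continuousAt_const hx
    have heq : collarCutoff a R₁ R₂ =ᶠ[𝓝 x] fun _ ↦ (1 : ℝ) := by
      filter_upwards [hev] with y hy
      exact collarCutoff_eq_one hR hy.le
    rw [heq.fderiv_eq]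
    simp
  · have hev : ∀ᶠ y in 𝓝 x, R₂ < radius a y :=
      continuousAt_const.eventually_lt (continuous_radius a).continuousAt hx
    have heq : collarCutoff a R₁ R₂ =ᶠ[𝓝 x] fun _ ↦ (0 : ℝ) := by
      filter_upwards [hev] with y hy
      exact collarCutoff_eq_zero hR hy.le
    rw [heq.fderiv_eq]
    simp

/-- **The differential of `χ` is bounded and supported in the shell**: there is `L ≥ 0` with
`|∂_μ χ(x)| ≤ L` everywhere and `∂_μχ(x) = 0` unless `R₁ ≤ r(x) ≤ R₂` (`0 < R₁ < R₂`; the partial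
derivatives are continuous and `t*`-invariant, hence bounded on the compact slab
`{x⁰ = 0, R₁ ≤ r ≤ R₂}`). [folklore] -/
theorem exists_abs_fderiv_collarCutoff_le {a R₁ R₂ : ℝ} (hR₁ : 0 < R₁) (hR : R₁ < R₂) :
    ∃ L : ℝ, 0 ≤ L ∧ ∀ (x : E4) (μ : Fin 4),
      |fderiv ℝ (collarCutoff a R₁ R₂) x (E4.basisVector μ)| ≤ L ∧
        (fderiv ℝ (collarCutoff a R₁ R₂) x (E4.basisVector μ) ≠ 0 →
          R₁ ≤ radius a x ∧ radius a x ≤ R₂) := by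
  have hχ : ContDiff ℝ 1 (collarCutoff a R₁ R₂) := contDiff_collarCutoff hR₁ hR
  have hcont : ∀ μ, Continuous fun x ↦ fderiv ℝ (collarCutoff a R₁ R₂) x (E4.basisVector μ) :=
    fun μ ↦ (hχ.continuous_fderiv one_ne_zero).clm_apply continuous_const
  have hinv : ∀ (μ : Fin 4) (x : E4) (t : ℝ),
      fderiv ℝ (collarCutoff a R₁ R₂) (x + t • E4.basisVector 0) (E4.basisVector μ) =
        fderiv ℝ (collarCutoff a R₁ R₂) x (E4.basisVector μ) := by
    intro μ x t
    set g : E4 → ℝ := collarCutoff a R₁ R₂ with hg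
    rw [← fderiv_comp_add_right]
    simp only [hg, collarCutoff_add_smul_basisVector_zero]
  have h : ∀ μ, ∃ C : ℝ, ∀ x : E4, R₁ ≤ radius a x → radius a x ≤ R₂ →
      |fderiv ℝ (collarCutoff a R₁ R₂) x (E4.basisVector μ)| ≤ C := fun μ ↦
    exists_forall_abs_le_of_continuousOn_slab a hR₁ _ (hcont μ).continuousOn (hinv μ)
  choose C hC using h
  set L : ℝ := max 0 (Finset.univ.sup' Finset.univ_nonempty C) with hL
  have hshell : ∀ (x : E4) (μ : Fin 4), fderiv ℝ (collarCutoff a R₁ R₂) x (E4.basisVector μ) ≠ 0 →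
      R₁ ≤ radius a x ∧ radius a x ≤ R₂ := by
    intro x μ hne
    by_contra hout
    rw [not_and_or, not_le, not_le] at hout
    exact hne (by rw [fderiv_collarCutoff_eq_zero hR hout]; rfl)
  refine ⟨L, le_max_left _ _, fun x μ ↦ ⟨?_, hshell x μ⟩⟩
  by_cases hne : fderiv ℝ (collarCutoff a R₁ R₂) x (E4.basisVector μ) = 0
  · rw [hne, abs_zero]; exact le_max_left _ _
  · obtain ⟨h1, h2⟩ := hshell x μ hne
    exact (hC μ x h1 h2).trans ((Finset.le_sup' C (Finset.mem_univ μ)).trans (le_max_right _ _))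

/-! ## Part 3. The weight: radial cut-off times receding horizon factor -/

/-- **The weight of the red-shift estimate**: `W_ε = χ · σ(u₂/ε − 1)`, the radial cut-off times the
receding horizon factor of `KerrDomainOfDependence.lean` (`u₂ = Kerr.horizonFn`). It is supported in
`{ε ≤ u₂} ∩ {r ≤ R₂} ⊆ {r > r₊}`, increases to `χ · 1_{r > r₊}` as `ε ↓ 0`, and its differential
splits as `χ d[σ(u₂/ε − 1)] + σ(u₂/ε − 1) dχ`: the first flux has a sign
(`Kerr.redShift_horizonFactor_flux`, `Kerr.horizonFactor_flux`), the second is an error supported in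
the shell `{R₁ ≤ r ≤ R₂}`. [cite: DafermosRodnianskiShlapentokhrothman2014, §2.3.2] -/
def redShiftWeight (M a R₁ R₂ ε : ℝ) (x : E4) : ℝ :=
  collarCutoff a R₁ R₂ x * Real.smoothTransition (horizonFn M a x / ε - 1)

/-- The support set `K_ε = {ε ≤ u₂} ∩ {r ≤ R₂}` of the weight. [folklore] -/
def redShiftWeightSet (M a R₂ ε : ℝ) : Set E4 :=
  {x | ε ≤ horizonFn M a x ∧ radius a x ≤ R₂}

/-- `0 ≤ W_ε`. [folklore] -/
theorem redShiftWeight_nonneg (M a R₁ R₂ ε : ℝ) (x : E4) : 0 ≤ redShiftWeight M a R₁ R₂ ε x :=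
  mul_nonneg (collarCutoff_nonneg a R₁ R₂ x) (Real.smoothTransition.nonneg _)

/-- `W_ε ≤ 1`. [folklore] -/
theorem redShiftWeight_le_one (M a R₁ R₂ ε : ℝ) (x : E4) : redShiftWeight M a R₁ R₂ ε x ≤ 1 :=
  mul_le_one₀ (collarCutoff_le_one a R₁ R₂ x) (Real.smoothTransition.nonneg _)
    (Real.smoothTransition.le_one _)

/-- `W_ε ≤ χ`. [folklore] -/
theorem redShiftWeight_le_collarCutoff (M a R₁ R₂ ε : ℝ) (x : E4) :
    redShiftWeight M a R₁ R₂ ε x ≤ collarCutoff a R₁ R₂ x :=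
  mul_le_of_le_one_right (collarCutoff_nonneg a R₁ R₂ x) (Real.smoothTransition.le_one _)

/-- `W_ε` is `C¹` on `ℝ⁴` (`0 < R₁ < R₂`, `r₊ > 0`, `ε > 0`). [folklore] -/
theorem contDiff_redShiftWeight {M a R₁ R₂ ε : ℝ} (hR₁ : 0 < R₁) (hR : R₁ < R₂) (hr : 0 < rPlus M a)
    (hε : 0 < ε) : ContDiff ℝ 1 (redShiftWeight M a R₁ R₂ ε) :=
  (contDiff_collarCutoff hR₁ hR).mul (contDiff_horizonFactor hr hε)

/-- The support set is closed. [folklore] -/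
theorem isClosed_redShiftWeightSet (M a R₂ ε : ℝ) : IsClosed (redShiftWeightSet M a R₂ ε) := by
  have hc0 : Continuous fun x : E4 ↦ x 0 := (E4.dx 0).continuous
  have hh : Continuous (horizonFn M a) := by
    show Continuous fun x ↦ (radius a x - rPlus M a) * Real.exp (-((2 * M)⁻¹ * x 0))
    exact ((continuous_radius a).sub continuous_const).mul
      (Real.continuous_exp.comp (continuous_const.mul hc0).neg)
  rw [redShiftWeightSet, Set.setOf_and]
  exact (isClosed_le continuous_const hh).inter (isClosed_le (continuous_radius a) continuous_const)

/-- Points of the support set are exterior points: `u₂ ≥ ε > 0` forces `r > r₊`. [folklore] -/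
theorem rPlus_lt_radius_of_mem_redShiftWeightSet {M a R₂ ε : ℝ} (hε : 0 < ε)
    (hx : x ∈ redShiftWeightSet M a R₂ ε) : rPlus M a < radius a x :=
  rPlus_lt_radius_of_horizonFn_pos (lt_of_lt_of_le hε hx.1)

/-- The support set lies in the exterior chart. [folklore] -/
theorem redShiftWeightSet_subset_exterior {M a R₂ ε : ℝ} (hr : 0 < rPlus M a) (hε : 0 < ε) :
    redShiftWeightSet M a R₂ ε ⊆ (exterior M a : Set E4) := fun _ hx ↦
  mem_exterior.2 (max_lt (rPlus_lt_radius_of_mem_redShiftWeightSet hε hx)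
    (hr.trans (rPlus_lt_radius_of_mem_redShiftWeightSet hε hx)))

/-- Where the weight is nonzero, the point lies in the support set (`R₁ < R₂`, `ε > 0`).
[folklore] -/
theorem mem_redShiftWeightSet_of_ne_zero {M a R₁ R₂ ε : ℝ} (hR : R₁ < R₂) (hε : 0 < ε)
    (hx : redShiftWeight M a R₁ R₂ ε x ≠ 0) : x ∈ redShiftWeightSet M a R₂ ε := by
  have hχ : collarCutoff a R₁ R₂ x ≠ 0 := left_ne_zero_of_mul hx
  have hσ : Real.smoothTransition (horizonFn M a x / ε - 1) ≠ 0 := right_ne_zero_of_mul hx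
  refine ⟨?_, (radius_lt_of_collarCutoff_ne_zero hR hχ).le⟩
  by_contra hlt
  rw [not_le] at hlt
  refine hσ (Real.smoothTransition.zero_of_nonpos ?_)
  rw [sub_nonpos, div_le_one hε]
  exact hlt.le

/-- Points of the support set have `‖x⃗‖ ≤ √(R₂² + a²)` (`r₊ > 0`, `ε > 0`). [folklore] -/
theorem spatialNorm_le_of_mem_redShiftWeightSet {M a R₂ ε : ℝ} (hr : 0 < rPlus M a) (hε : 0 < ε)
    (hx : x ∈ redShiftWeightSet M a R₂ ε) : E4.spatialNorm x ≤ √(R₂ ^ 2 + a ^ 2) := by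
  have hxpos : 0 < radius a x := hr.trans (rPlus_lt_radius_of_mem_redShiftWeightSet hε hx)
  have h1 := spatialNorm_sq_le hxpos
  have h2 : radius a x ^ 2 ≤ R₂ ^ 2 := pow_le_pow_left₀ hxpos.le hx.2 2
  calc E4.spatialNorm x = √(E4.spatialNorm x ^ 2) := (Real.sqrt_sq (E4.spatialNorm_nonneg x)).symm
    _ ≤ √(R₂ ^ 2 + a ^ 2) := Real.sqrt_le_sqrt (by linarith)

end Kerr

/-! ## Part 4. The energy inequality along a graph foliation for a current with signed divergence -/

namespace E4

/-- **The energy inequality along a graph foliation for a current with signed divergence.** Let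
`K ⊆ ℝ⁴` be closed, `J` a `C¹` current on `ℝ⁴` vanishing off `K`, `F` a `C²` height, and assume
that the points of `K` in the slab `{F(x⃗) ≤ x⁰ ≤ T + F(x⃗)}` have `‖x⃗‖ ≤ ρ`. If
`∑_μ ∂_μ J^μ ≤ −ℓ + e` at the points of `K` in the slab, for continuous `ℓ, e` with `ℓ = 0` off `K`
and `e ≥ 0`, then the fluxes `f(t) = ∫_{‖y‖ ≤ ρ} ∑_μ J^μ n_μ (t + F(y), y) dy` (`n = dt − dF`)
satisfy, for `0 ≤ s ≤ T`,
`f(s) + ∫_0^s ∫_{‖y‖ ≤ ρ} ℓ(u + F(y), y) dy du ≤ f(0) + ∫_0^s ∫_{‖y‖ ≤ ρ} e(u + F(y), y) dy du`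
(the divergence identity `E4.graphFlux_sub_eq_integral_divergence` between the graphs of `F` and
`s + F`, the substitution `u = θ s`, and monotonicity of the integral). This is the form in which an
energy identity with a bulk term of good sign and a localised error is used
(Dafermos–Rodnianski–Shlapentokh-Rothman arXiv:1402.7034, §2.3.2 (ingeneralform2), Prop. 4.5.2).
[cite: DafermosRodnianskiShlapentokhrothman2014, §2.3.2] -/
theorem graphFlux_add_integral_le_of_divergence_le {K : Set E4} (hKc : IsClosed K)
    {J : Fin 4 → E4 → ℝ} (hJ1 : ∀ μ, ContDiff ℝ 1 (J μ)) (hJK : ∀ μ x, x ∉ K → J μ x = 0)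
    {F : E3 → ℝ} (hF : ContDiff ℝ 2 F) {T ρ : ℝ}
    (hρ : ∀ x ∈ K, F (E4.spatial x) ≤ x 0 → x 0 ≤ T + F (E4.spatial x) → E4.spatialNorm x ≤ ρ)
    {ℓ e : E4 → ℝ} (hℓc : Continuous ℓ) (hec : Continuous e) (hℓK : ∀ x, x ∉ K → ℓ x = 0)
    (he0 : ∀ x, 0 ≤ e x)
    (hdiv : ∀ x ∈ K, F (E4.spatial x) ≤ x 0 → x 0 ≤ T + F (E4.spatial x) →
      ∑ μ, fderiv ℝ (J μ) x (E4.basisVector μ) ≤ -ℓ x + e x)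
    {s : ℝ} (hs0 : 0 ≤ s) (hsT : s ≤ T) :
    (∫ y in closedBall (0 : E3) ρ, ∑ μ, J μ (E4.ofTimeSpace (s + F y) y) * Kerr.graphConormal F y μ) +
        ∫ u in Set.Ioc 0 s, ∫ y in closedBall (0 : E3) ρ, ℓ (E4.ofTimeSpace (u + F y) y) ≤
      (∫ y in closedBall (0 : E3) ρ, ∑ μ, J μ (E4.ofTimeSpace (0 + F y) y) * Kerr.graphConormal F y μ) +
        ∫ u in Set.Ioc 0 s, ∫ y in closedBall (0 : E3) ρ, e (E4.ofTimeSpace (u + F y) y) := by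
  -- ### notation
  set q : E4 → ℝ := fun x ↦ ∑ μ, J μ x * Kerr.graphConormal F (E4.spatial x) μ with hq
  set d : E4 → ℝ := fun x ↦ ∑ μ, fderiv ℝ (J μ) x (E4.basisVector μ) with hd
  have hF1 : ContDiff ℝ 1 F := hF.of_le one_le_two
  -- vanishing off `K`
  have hdJ0 : ∀ μ x, x ∉ K → fderiv ℝ (J μ) x = 0 := fun μ x hx ↦
    fderiv_eq_zero_of_forall_mem_eq_zero hKc.isOpen_compl (fun y hy ↦ hJK μ y hy) hx
  have hqK : ∀ x, x ∉ K → q x = 0 := fun x hx ↦ by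
    simp only [hq, hJK _ x hx, zero_mul, Finset.sum_const_zero]
  have hdK : ∀ x, x ∉ K → d x = 0 := fun x hx ↦ by
    simp only [hd, hdJ0 _ x hx, zero_apply, Finset.sum_const_zero]
  -- continuity
  have hnc : ∀ μ, Continuous fun x : E4 ↦ Kerr.graphConormal F (E4.spatial x) μ := by
    intro μ
    refine Fin.cases ?_ (fun i ↦ ?_) μ
    · simp only [Kerr.graphConormal_zero]; exact continuous_const
    · simp only [Kerr.graphConormal_succ, Kerr.partialE3]
      exact (((hF1.continuous_fderiv one_ne_zero).comp E4.spatial.continuous).clm_apply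
        continuous_const).neg
  have hqc : Continuous q := continuous_finsetSum _ fun μ _ ↦ ((hJ1 μ).continuous).mul (hnc μ)
  have hdc : Continuous d := continuous_finsetSum _ fun μ _ ↦
    ((hJ1 μ).continuous_fderiv one_ne_zero).clm_apply continuous_const
  have hgraphc : Continuous fun p : ℝ × E3 ↦ E4.ofTimeSpace (p.1 + F p.2) p.2 :=
    E4.continuous_ofTimeSpace' (continuous_fst.add (hF.continuous.comp continuous_snd))
      continuous_snd
  have hgraphu : ∀ u : ℝ, Continuous fun y : E3 ↦ E4.ofTimeSpace (u + F y) y := fun u ↦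
    E4.continuous_ofTimeSpace' (continuous_const.add hF.continuous) continuous_id
  -- points of the graphs of `t + F`, `0 ≤ t ≤ T`, lie in the slab
  have hslab : ∀ (t : ℝ) (y : E3), 0 ≤ t → t ≤ T →
      F (E4.spatial (E4.ofTimeSpace (t + F y) y)) ≤ (E4.ofTimeSpace (t + F y) y) 0 ∧
        (E4.ofTimeSpace (t + F y) y) 0 ≤ T + F (E4.spatial (E4.ofTimeSpace (t + F y) y)) := by
    intro t y ht0 htT
    simp only [E4.spatial_ofTimeSpace, E4.ofTimeSpace_apply_zero]
    exact ⟨by linarith, by linarith⟩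
  -- off the ball, the leaf points are not in `K`
  have hnotK : ∀ (t : ℝ) (y : E3), 0 ≤ t → t ≤ T → y ∉ closedBall (0 : E3) ρ →
      E4.ofTimeSpace (t + F y) y ∉ K := by
    intro t y ht0 htT hy hK
    rw [mem_closedBall, dist_zero_right, not_le] at hy
    have h := hρ _ hK (hslab t y ht0 htT).1 (hslab t y ht0 htT).2
    rw [E4.spatialNorm_ofTimeSpace] at h
    linarith
  have hfarJ : ∀ μ (x : E4), ρ < E4.spatialNorm x → 0 + F (E4.spatial x) ≤ x 0 →
      x 0 ≤ 0 + (s + F (E4.spatial x)) → J μ x = 0 := by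
    intro μ x hxρ h1 h2
    refine hJK μ x fun hK ↦ ?_
    have := hρ x hK (by linarith) (by linarith)
    linarith
  -- ### the slice functions
  set f : ℝ → ℝ := fun t ↦ ∫ y in closedBall (0 : E3) ρ, q (E4.ofTimeSpace (t + F y) y) with hf
  set g : ℝ → ℝ := fun t ↦ ∫ y in closedBall (0 : E3) ρ, d (E4.ofTimeSpace (t + F y) y) with hg
  set Lℓ : ℝ → ℝ := fun t ↦ ∫ y in closedBall (0 : E3) ρ, ℓ (E4.ofTimeSpace (t + F y) y) with hLℓ
  set Le : ℝ → ℝ := fun t ↦ ∫ y in closedBall (0 : E3) ρ, e (E4.ofTimeSpace (t + F y) y) with hLe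
  have hgc : Continuous g :=
    continuous_parametric_integral_of_continuous (f := fun (t : ℝ) (y : E3) ↦
      d (E4.ofTimeSpace (t + F y) y)) (hdc.comp hgraphc) (isCompact_closedBall _ _)
  have hLℓc : Continuous Lℓ :=
    continuous_parametric_integral_of_continuous (f := fun (t : ℝ) (y : E3) ↦
      ℓ (E4.ofTimeSpace (t + F y) y)) (hℓc.comp hgraphc) (isCompact_closedBall _ _)
  have hLec : Continuous Le :=
    continuous_parametric_integral_of_continuous (f := fun (t : ℝ) (y : E3) ↦
      e (E4.ofTimeSpace (t + F y) y)) (hec.comp hgraphc) (isCompact_closedBall _ _)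
  -- the statement is about `f s`, `f 0`, `∫ Lℓ`, `∫ Le`
  have hfq : ∀ t, (∫ y in closedBall (0 : E3) ρ,
      ∑ μ, J μ (E4.ofTimeSpace (t + F y) y) * Kerr.graphConormal F y μ) = f t := by
    intro t
    simp only [hf, hq, E4.spatial_ofTimeSpace]
  rw [hfq s, hfq 0]
  change f s + ∫ u in Set.Ioc 0 s, Lℓ u ≤ f 0 + ∫ u in Set.Ioc 0 s, Le u
  -- ### the divergence identity between the graphs of `F` and `s + F`
  have hE3f : ∀ t', 0 ≤ t' → t' ≤ T → (∫ y, q (E4.ofTimeSpace (t' + F y) y)) = f t' := by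
    intro t' h0 h1
    rw [hf]
    exact (setIntegral_eq_integral_of_forall_compl_eq_zero
      (fun y hy ↦ hqK _ (hnotK t' y h0 h1 hy))).symm
  have hE3g : ∀ t', 0 ≤ t' → t' ≤ T → (∫ y, d (E4.ofTimeSpace (t' + F y) y)) = g t' := by
    intro t' h0 h1
    rw [hg]
    exact (setIntegral_eq_integral_of_forall_compl_eq_zero
      (fun y hy ↦ hdK _ (hnotK t' y h0 h1 hy))).symm
  have hfluxq : ∀ (t' : ℝ) (y : E3), ∑ μ, J μ (E4.ofTimeSpace (t' + F y) y) *
      Kerr.graphConormal F y μ = q (E4.ofTimeSpace (t' + F y) y) := by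
    intro t' y
    simp only [hq, E4.spatial_ofTimeSpace]
  have hident : f s - f 0 = ∫ θ in Set.Ioc (0 : ℝ) 1, s * g (θ * s) := by
    have hF₂ : ContDiff ℝ 2 (fun y ↦ s + F y) := contDiff_const.add hF
    have hle : ∀ y, F y ≤ s + F y := fun y ↦ by linarith
    have hid := E4.graphFlux_sub_eq_integral_divergence hJ1 hF hF₂ hle (τ := 0) (ρ := ρ) hfarJ
    have hncong : ∀ (y : E3) (μ : Fin 4),
        Kerr.graphConormal (fun y ↦ s + F y) y μ = Kerr.graphConormal F y μ := by
      intro y μ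
      refine Fin.cases rfl (fun i ↦ ?_) μ
      simp only [Kerr.graphConormal_succ, Kerr.partialE3, fderiv_const_add]
    have hL1 : (∫ y, ∑ μ, J μ (E4.ofTimeSpace (0 + (s + F y)) y) *
        Kerr.graphConormal (fun y ↦ s + F y) y μ) = f s := by
      simp only [zero_add, hncong, hfluxq]
      exact hE3f s hs0 hsT
    have hL2 : (∫ y, ∑ μ, J μ (E4.ofTimeSpace (0 + F y) y) * Kerr.graphConormal F y μ) = f 0 := by
      simp only [hfluxq]
      exact hE3f 0 le_rfl (hs0.trans hsT)
    have hR : (∫ θ in Set.Ioc (0 : ℝ) 1, ∫ y, ((s + F y) - F y) *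
        ∑ μ, fderiv ℝ (J μ) (E4.ofTimeSpace (0 + (F y + θ * ((s + F y) - F y))) y)
          (E4.basisVector μ)) = ∫ θ in Set.Ioc (0 : ℝ) 1, s * g (θ * s) := by
      refine setIntegral_congr_fun measurableSet_Ioc fun θ hθ ↦ ?_
      have hθt0 : 0 ≤ θ * s := mul_nonneg hθ.1.le hs0
      have hθtT : θ * s ≤ T := (mul_le_of_le_one_left hs0 hθ.2).trans hsT
      simp only [add_sub_cancel_right, zero_add]
      rw [MeasureTheory.integral_const_mul]
      congr 1
      have : ∀ y, E4.ofTimeSpace (F y + θ * s) y = E4.ofTimeSpace (θ * s + F y) y := fun y ↦ by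
        rw [add_comm]
      simp only [this]
      exact hE3g (θ * s) hθt0 hθtT
    rw [← hL1, ← hL2, ← hR]
    exact hid
  -- ### the substitution `u = θ s`
  have hsub : ∫ θ in Set.Ioc (0 : ℝ) 1, s * g (θ * s) = ∫ u in Set.Ioc 0 s, g u := by
    have h := intervalIntegral.smul_integral_comp_mul_right (f := g) (a := 0) (b := 1) s
    rw [smul_eq_mul, zero_mul, one_mul] at h
    rw [← intervalIntegral.integral_of_le zero_le_one, ← intervalIntegral.integral_of_le hs0,
      intervalIntegral.integral_const_mul, h]
  -- ### monotonicity: `g u ≤ −Lℓ u + Le u` for `0 ≤ u ≤ T`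
  have hgle : ∀ u, 0 ≤ u → u ≤ T → g u ≤ -Lℓ u + Le u := by
    intro u hu0 huT
    have hi1 : IntegrableOn (fun y : E3 ↦ d (E4.ofTimeSpace (u + F y) y)) (closedBall (0 : E3) ρ) :=
      (hdc.comp (hgraphu u)).continuousOn.integrableOn_compact (isCompact_closedBall _ _)
    have hi2 : IntegrableOn (fun y : E3 ↦ -ℓ (E4.ofTimeSpace (u + F y) y) +
        e (E4.ofTimeSpace (u + F y) y)) (closedBall (0 : E3) ρ) :=
      ((hℓc.comp (hgraphu u)).neg.add (hec.comp (hgraphu u))).continuousOn.integrableOn_compact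
        (isCompact_closedBall _ _)
    have hmono : g u ≤ ∫ y in closedBall (0 : E3) ρ, (-ℓ (E4.ofTimeSpace (u + F y) y) +
        e (E4.ofTimeSpace (u + F y) y)) := by
      refine setIntegral_mono_on hi1 hi2 measurableSet_closedBall fun y _ ↦ ?_
      set x := E4.ofTimeSpace (u + F y) y with hx
      by_cases hxK : x ∈ K
      · exact hdiv x hxK (hslab u y hu0 huT).1 (hslab u y hu0 huT).2
      · rw [show d x = 0 from hdK x hxK, hℓK x hxK, neg_zero, zero_add]
        exact he0 x
    have hiℓ : Integrable (fun y : E3 ↦ -ℓ (E4.ofTimeSpace (u + F y) y))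
        (volume.restrict (closedBall (0 : E3) ρ)) := by
      have h : Continuous fun y : E3 ↦ -ℓ (E4.ofTimeSpace (u + F y) y) :=
        (hℓc.comp (hgraphu u)).neg
      exact h.continuousOn.integrableOn_compact (isCompact_closedBall _ _)
    have hie : Integrable (fun y : E3 ↦ e (E4.ofTimeSpace (u + F y) y))
        (volume.restrict (closedBall (0 : E3) ρ)) := by
      have h : Continuous fun y : E3 ↦ e (E4.ofTimeSpace (u + F y) y) := hec.comp (hgraphu u)
      exact h.continuousOn.integrableOn_compact (isCompact_closedBall _ _)
    have hsplit : (∫ y in closedBall (0 : E3) ρ, (-ℓ (E4.ofTimeSpace (u + F y) y) +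
        e (E4.ofTimeSpace (u + F y) y))) = -Lℓ u + Le u := by
      rw [integral_add hiℓ hie, integral_neg]
    linarith
  have hint : ∫ u in Set.Ioc 0 s, g u ≤ ∫ u in Set.Ioc 0 s, (-Lℓ u + Le u) := by
    have h : Continuous fun u ↦ -Lℓ u + Le u := hLℓc.neg.add hLec
    refine setIntegral_mono_on (hgc.integrableOn_Icc.mono_set Set.Ioc_subset_Icc_self)
      (h.integrableOn_Icc.mono_set Set.Ioc_subset_Icc_self)
      measurableSet_Ioc fun u hu ↦ hgle u hu.1.le (hu.2.trans hsT)
  have hiL1 : Integrable (fun u ↦ -Lℓ u) (volume.restrict (Set.Ioc 0 s)) := by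
    have h : Continuous fun u ↦ -Lℓ u := hLℓc.neg
    exact h.integrableOn_Icc.mono_set Set.Ioc_subset_Icc_self
  have hiL2 : Integrable (fun u ↦ Le u) (volume.restrict (Set.Ioc 0 s)) :=
    hLec.integrableOn_Icc.mono_set Set.Ioc_subset_Icc_self
  have hsplit2 : ∫ u in Set.Ioc 0 s, (-Lℓ u + Le u) =
      -(∫ u in Set.Ioc 0 s, Lℓ u) + ∫ u in Set.Ioc 0 s, Le u := by
    rw [integral_add hiL1 hiL2, integral_neg]
  have h1 : f s - f 0 = ∫ u in Set.Ioc 0 s, g u := by rw [hident, hsub]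
  linarith

end E4

/-! ## Part 5. The red-shift estimate between graph leaves at fixed receding parameter -/

namespace Kerr

variable {M a : ℝ} {x : E4}

/-- The conormal `dt* − dF` of a graph leaf of slope `∑ (∂_iF)² ≤ 1` is admissible. [folklore] -/
theorem graphConormal_mem_admissibleConormals {F : E3 → ℝ} {y : E3}
    (hF : ∑ i, partialE3 F y i ^ 2 ≤ 1) : graphConormal F y ∈ admissibleConormals :=
  ⟨graphConormal_zero F y, by simpa only [graphConormal_succ, neg_sq] using hF⟩

/-- The components of an admissible conormal are bounded by `1`. [folklore] -/
theorem abs_apply_le_one_of_mem_admissibleConormals {n : Fin 4 → ℝ}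
    (hn : n ∈ admissibleConormals) (μ : Fin 4) : |n μ| ≤ 1 := by
  refine Fin.cases ?_ (fun i ↦ ?_) μ
  · rw [hn.1, abs_one]
  · have h : n i.succ ^ 2 ≤ 1 :=
      (Finset.single_le_sum (fun j _ ↦ sq_nonneg (n (Fin.succ j))) (Finset.mem_univ i)).trans hn.2
    exact (sq_le_one_iff_abs_le_one _).mp h

/-- `r₊ − M > 0` for subextremal parameters (`r₊ − M = √(M² − a²)`). [folklore] -/
theorem IsSubextremal.rPlus_sub_self_pos (hMa : IsSubextremal M a) : 0 < rPlus M a - M := by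
  rw [rPlus_sub_self]
  refine Real.sqrt_pos.2 (sub_pos.2 ?_)
  have ha : |a| < M := hMa
  have := sq_lt_sq' (abs_lt.1 ha).1 (abs_lt.1 ha).2
  simpa using this

/-- **The red-shift estimate between admissible graph leaves, at fixed receding parameter**
(Dafermos–Rodnianski–Shlapentokh-Rothman, Prop. 4.5.2, in the form of the first display of §13.2,
before the limit `ε → 0`). For subextremal `(M, a)` there is `η₀ > 0` (a collar width on which the
red-shift vector field `N` of `Kerr.redShiftVector` has coercive bulk, `KerrRedShiftCoercivity`, and
is timelike with `N⁰ ≥ 1` and `n(N) ≥ b` for admissible conormals, `KerrRedShiftTimelike`) such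
that for every `0 < η ≤ η₀` there are constants `A > 0`, `C ≥ 0` with: for every `C²` height `F`
of slope `∑(∂_iF)² ≤ (1 − c)²`
(`0 < c ≤ 1`), every `Φ` of class `C²` on the exterior solving the wave equation of the surgered
background `Kerr.surgeryBackground M a r₊` there (i.e. `□_{g_{M,a}}Φ = 0` on `{r > r₊}`), every
`ε > 0` and every `s ≥ 0`, with `W_ε = χ σ(u₂/ε − 1)` the weight `Kerr.redShiftWeight` for the radii
`R₁ = r₊ + η/2 < R₂ = r₊ + η` and `Σ̃_u = {(u + F(y), y)}`,
`A c ∫_{Σ̃_s} W_ε ∑(∂Φ)² dy + A ∫_0^s ∫_{Σ̃_u} W_ε ∑(∂Φ)² dy du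
  ≤ C ∫_{Σ̃_0} W_ε ∑(∂Φ)² dy + C ∫_0^s ∫_{Σ̃_u} (∑_μ |∂_μχ|) ∑(∂Φ)² dy du`
(all `y`-integrals over the ball `‖y‖ ≤ √(R₂² + a²)` containing the spatial projection of the
support of `W_ε`). Proof: `E4.graphFlux_add_integral_le_of_divergence_le` for the current
`W_ε (−J^N + ε₀ J^{dt*})[Φ]`: its divergence is
`χ (dσ·(−J^N + ε₀J^{dt*})) + σ (dχ·(…)) + W_ε(−K^N + ε₀ R)` with the first term `≤ 0`
(`Kerr.redShift_horizonFactor_flux`, `Kerr.horizonFactor_flux`), the second bounded by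
`C (∑|∂χ|) ∑(∂Φ)²` (`abs_multiplierCurrent_le`, `abs_normalCurrent_le`), the third
`≤ −(b/2) W_ε ∑(∂Φ)²` for `ε₀` small (`Kerr.exists_redShift_bulk_coercive`, `abs_deformationTerm_le`);
the leaf flux is `≥ ε₀ c W_ε ∑(∂Φ)²/6` (`Kerr.neg_sum_redShiftCurrent_mul_nonneg`,
`mul_normalCurrent_zero_le_graphFlux`, `sum_sq_le_six_mul_normalCurrent_zero`) and `≤ C W_ε ∑(∂Φ)²`.
[cite: DafermosRodnianskiShlapentokhrothman2014, Prop. 4.5.2 and §13.2] -/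
theorem redShift_weighted_estimate (hMa : IsSubextremal M a) :
    ∃ η₀ : ℝ, 0 < η₀ ∧ ∀ η : ℝ, 0 < η → η ≤ η₀ → ∃ A C : ℝ, 0 < A ∧ 0 ≤ C ∧
      ∀ (F : E3 → ℝ) (c : ℝ), ContDiff ℝ 2 F → 0 < c → c ≤ 1 →
      (∀ y, ∑ i, partialE3 F y i ^ 2 ≤ (1 - c) ^ 2) →
      ∀ Φ : E4 → ℝ, (∀ x ∈ (exterior M a : Set E4), ContDiffAt ℝ 2 Φ x) →
      (∀ x ∈ (exterior M a : Set E4), KerrSchild.waveOperator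
          (surgeryBackground M a (rPlus M a) hMa.pos.le hMa.rPlus_pos).inverseMetric Φ x = 0) →
      ∀ ε : ℝ, 0 < ε → ∀ s : ℝ, 0 ≤ s →
        A * c * (∫ y in closedBall (0 : E3) √((rPlus M a + η) ^ 2 + a ^ 2),
            redShiftWeight M a (rPlus M a + η / 2) (rPlus M a + η) ε (E4.ofTimeSpace (s + F y) y) *
              ∑ μ, fderiv ℝ Φ (E4.ofTimeSpace (s + F y) y) (E4.basisVector μ) ^ 2) +
          A * ∫ u in Set.Ioc 0 s, ∫ y in closedBall (0 : E3) √((rPlus M a + η) ^ 2 + a ^ 2),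
            redShiftWeight M a (rPlus M a + η / 2) (rPlus M a + η) ε (E4.ofTimeSpace (u + F y) y) *
              ∑ μ, fderiv ℝ Φ (E4.ofTimeSpace (u + F y) y) (E4.basisVector μ) ^ 2 ≤
        C * (∫ y in closedBall (0 : E3) √((rPlus M a + η) ^ 2 + a ^ 2),
            redShiftWeight M a (rPlus M a + η / 2) (rPlus M a + η) ε (E4.ofTimeSpace (0 + F y) y) *
              ∑ μ, fderiv ℝ Φ (E4.ofTimeSpace (0 + F y) y) (E4.basisVector μ) ^ 2) +
          C * ∫ u in Set.Ioc 0 s, ∫ y in closedBall (0 : E3) √((rPlus M a + η) ^ 2 + a ^ 2),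
            (∑ μ, |fderiv ℝ (collarCutoff a (rPlus M a + η / 2) (rPlus M a + η))
                (E4.ofTimeSpace (u + F y) y) (E4.basisVector μ)|) *
              ∑ μ, fderiv ℝ Φ (E4.ofTimeSpace (u + F y) y) (E4.basisVector μ) ^ 2 := by
  -- ### constants of the background
  have hM : 0 < M := hMa.pos
  have hrp : 0 < rPlus M a := hMa.rPlus_pos
  have hδ : 0 < rPlus M a - M := hMa.rPlus_sub_self_pos
  set hp : ℝ := 16 / (rPlus M a - M) with hhp
  have hhp16 : 16 ≤ (rPlus M a - M) * hp := by rw [hhp, mul_div_cancel₀ _ hδ.ne']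
  have hp0 : 0 < hp := by positivity
  -- the collars of `N`
  obtain ⟨η₁, hη₁, b₁, hb₁, hcoer⟩ := exists_redShift_bulk_coercive hMa hhp16 hhp16
  obtain ⟨η₂, hη₂, b₂, hb₂, hcol⟩ := exists_redShift_timelike_collar hMa hp hp
  refine ⟨min η₁ η₂, lt_min hη₁ hη₂, fun η hη hηle ↦ ?_⟩
  have hηle₁ : η ≤ η₁ := hηle.trans (min_le_left _ _)
  have hηle₂ : η ≤ η₂ := hηle.trans (min_le_right _ _)
  -- the surgered background and its bounds
  set B := surgeryBackground M a (rPlus M a) hMa.pos.le hMa.rPlus_pos with hB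
  have hΦb0 : 0 ≤ B.bound := (B.φ_nonneg 0).trans (B.φ_le 0)
  obtain ⟨D, hD0, hD⟩ :=
    exists_bound_fderiv_surgeryBackground_inverseMetric hMa.pos.le a hMa.rPlus_pos
  obtain ⟨Ξ, hΞ0, hΞ⟩ :=
    exists_abs_redShiftVector_le M a hp hp hrp (r₀ := rPlus M a) (R := rPlus M a + η)
  -- radii and the cut-off bound
  set R₁ : ℝ := rPlus M a + η / 2 with hR₁
  set R₂ : ℝ := rPlus M a + η with hR₂
  have hR₁pos : 0 < R₁ := by positivity
  have hR12 : R₁ < R₂ := by rw [hR₁, hR₂]; linarith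
  have hrR₁ : rPlus M a < R₁ := by rw [hR₁]; linarith
  obtain ⟨L, hL0, hL⟩ := exists_abs_fderiv_collarCutoff_le (a := a) hR₁pos hR12
  -- the constants
  set CJ : ℝ := 6 * (1 + B.bound) * Ξ + 6 * (1 + B.bound) ^ 2 with hCJ
  have hCJ0 : 0 ≤ CJ := by positivity
  set ε₀ : ℝ := min 1 (b₁ / (2 * (32 * (1 + B.bound) * D + 1))) with hε₀
  have hε₀pos : 0 < ε₀ := lt_min one_pos (by positivity)
  have hε₀le1 : ε₀ ≤ 1 := min_le_left _ _
  have hε₀D : ε₀ * (32 * (1 + B.bound) * D) ≤ b₁ / 2 := by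
    have h1 : ε₀ ≤ b₁ / (2 * (32 * (1 + B.bound) * D + 1)) := min_le_right _ _
    have h2 : 0 ≤ 32 * (1 + B.bound) * D := by positivity
    calc ε₀ * (32 * (1 + B.bound) * D)
        ≤ b₁ / (2 * (32 * (1 + B.bound) * D + 1)) * (32 * (1 + B.bound) * D + 1) :=
          mul_le_mul h1 (by linarith) h2 (by positivity)
      _ = b₁ / 2 := by field_simp
  set A : ℝ := min (ε₀ / 6) (b₁ / 2) with hA
  have hApos : 0 < A := lt_min (by positivity) (by positivity)
  have hAε : A ≤ ε₀ / 6 := min_le_left _ _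
  have hAb : A ≤ b₁ / 2 := min_le_right _ _
  refine ⟨A, 4 * CJ, hApos, by positivity, fun F c hF hc hc1 hFc Φ hΦ hsol ε hε s hs ↦ ?_⟩
  -- ### notation
  set ρ : ℝ := √(R₂ ^ 2 + a ^ 2) with hρ
  set G := B.inverseMetric with hG
  set N : E4 → Fin 4 → ℝ := redShiftVector M a hp hp with hN
  set χ : E4 → ℝ := collarCutoff a R₁ R₂ with hχ
  set hf : E4 → ℝ := fun y ↦ Real.smoothTransition (horizonFn M a y / ε - 1) with hhf
  set W : E4 → ℝ := redShiftWeight M a R₁ R₂ ε with hW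
  set K : Set E4 := redShiftWeightSet M a R₂ ε with hK
  set U : Set E4 := (exterior M a : Set E4) with hU
  set p2 : E4 → ℝ := fun x ↦ ∑ μ, fderiv ℝ Φ x (E4.basisVector μ) ^ 2 with hp2
  set JN : Fin 4 → E4 → ℝ := fun μ x ↦ KerrSchild.multiplierCurrent G N Φ x μ with hJN
  set P : Fin 4 → E4 → ℝ := fun μ x ↦ KerrSchild.normalCurrent G Φ x μ with hP
  set Cur : Fin 4 → E4 → ℝ := fun μ x ↦ -JN μ x + ε₀ * P μ x with hCur
  set J : Fin 4 → E4 → ℝ := fun μ x ↦ W x * Cur μ x with hJ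
  set n : E4 → Fin 4 → ℝ := fun x μ ↦ graphConormal F (E4.spatial x) μ with hn
  set V : E4 → ℝ := fun x ↦ ∑ μ, |fderiv ℝ χ x (E4.basisVector μ)| with hV
  set ℓ : E4 → ℝ := fun x ↦ b₁ / 2 * (W x * p2 x) with hℓ
  set e : E4 → ℝ := fun x ↦ 4 * CJ * (V x * p2 x) with he
  have hp2nn : ∀ x, 0 ≤ p2 x := fun x ↦ Finset.sum_nonneg fun μ _ ↦ sq_nonneg _
  -- ### the weight and its support
  have hWdef : ∀ x, W x = χ x * hf x := fun x ↦ rfl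
  have hKc : IsClosed K := isClosed_redShiftWeightSet M a R₂ ε
  have hKU : K ⊆ U := redShiftWeightSet_subset_exterior hrp hε
  have hWK : ∀ x, W x ≠ 0 → x ∈ K := fun x hx ↦ mem_redShiftWeightSet_of_ne_zero hR12 hε hx
  have hWz : ∀ x, x ∉ K → W x = 0 := fun x hx ↦ by
    by_contra h
    exact hx (hWK x h)
  have hW1 : ContDiff ℝ 1 W := contDiff_redShiftWeight hR₁pos hR12 hrp hε
  have hW0 : ∀ x, 0 ≤ W x := redShiftWeight_nonneg M a R₁ R₂ ε
  have hWle : ∀ x, W x ≤ 1 := redShiftWeight_le_one M a R₁ R₂ ε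
  have hχ1 : ContDiff ℝ 1 χ := contDiff_collarCutoff hR₁pos hR12
  have hhf1 : ContDiff ℝ 1 hf := contDiff_horizonFactor hrp hε
  have hχ0 : ∀ x, 0 ≤ χ x := collarCutoff_nonneg a R₁ R₂
  have hhf0 : ∀ x, 0 ≤ hf x := fun x ↦ Real.smoothTransition.nonneg _
  have hhfle : ∀ x, hf x ≤ 1 := fun x ↦ Real.smoothTransition.le_one _
  have hV0 : ∀ x, 0 ≤ V x := fun x ↦ Finset.sum_nonneg fun μ _ ↦ abs_nonneg _
  -- geometry of the points of `K`
  have hKr : ∀ x ∈ K, rPlus M a < radius a x := fun x hx ↦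
    rPlus_lt_radius_of_mem_redShiftWeightSet hε hx
  have hKR₂ : ∀ x ∈ K, radius a x ≤ rPlus M a + η := fun x hx ↦ hx.2
  have hKabs : ∀ x ∈ K, |radius a x - rPlus M a| ≤ η := fun x hx ↦ by
    rw [abs_of_pos (sub_pos.mpr (hKr x hx))]
    linarith [hKR₂ x hx]
  have hUpos : ∀ x ∈ U, 0 < radius a x := fun x hx ↦ radius_pos_of_mem_region hx
  have hUr : ∀ x ∈ U, rPlus M a < radius a x := fun x hx ↦ lt_radius_of_mem_region hx
  -- ### regularity of the densities and currents at exterior points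
  have hpν : ∀ x ∈ U, ∀ ν, ContinuousAt (fun y ↦ fderiv ℝ Φ y (E4.basisVector ν)) x := by
    intro x hx ν
    have h2 : ContDiffAt ℝ ((1 : ℕ∞) + 1 : ℕ∞) Φ x := by exact_mod_cast hΦ x hx
    exact ((h2.fderiv_right (m := 1) le_rfl).clm_apply contDiffAt_const).continuousAt
  have hp2c : ∀ x ∈ U, ContinuousAt p2 x := fun x hx ↦
    tendsto_finsetSum _ fun ν _ ↦ (hpν x hx ν).pow 2
  have hP1 : ∀ μ, ∀ x ∈ U, ContDiffAt ℝ 1 (P μ) x := fun μ x hx ↦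
    B.contDiffAt_normalCurrent (hΦ x hx) μ
  have hJN1 : ∀ μ, ∀ x ∈ U, ContDiffAt ℝ 1 (JN μ) x := fun μ x hx ↦
    contDiffAt_redShiftCurrent hMa hp hp (hΦ x hx) (hUpos x hx) μ
  have hCur1 : ∀ μ, ∀ x ∈ U, ContDiffAt ℝ 1 (Cur μ) x := fun μ x hx ↦
    (hJN1 μ x hx).neg.add (contDiffAt_const.mul (hP1 μ x hx))
  have hJ1 : ∀ μ, ContDiff ℝ 1 (J μ) := fun μ ↦
    contDiff_iff_contDiffAt.mpr fun x ↦ contDiffAt_weight_mul hKc hKU hW1 hWK (hCur1 μ) x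
  have hJ0 : ∀ μ x, x ∉ K → J μ x = 0 := fun μ x hx ↦ by
    simp only [hJ, hWz x hx, zero_mul]
  -- continuity of `ℓ` and `e` on `ℝ⁴`
  have hℓc : Continuous ℓ :=
    continuous_const.mul (continuous_iff_continuousAt.mpr fun x ↦
      continuousAt_weight_mul hKc hKU hW1.continuous hWz hp2c x)
  have hℓK : ∀ x, x ∉ K → ℓ x = 0 := fun x hx ↦ by
    simp only [hℓ, hWz x hx, zero_mul, mul_zero]
  set Ksh : Set E4 := {x | R₁ ≤ radius a x ∧ radius a x ≤ R₂} with hKsh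
  have hKshc : IsClosed Ksh := by
    rw [hKsh, Set.setOf_and]
    exact (isClosed_le continuous_const (continuous_radius a)).inter
      (isClosed_le (continuous_radius a) continuous_const)
  have hKshU : Ksh ⊆ U := fun x hx ↦
    mem_exterior.2 (max_lt (hrR₁.trans_le hx.1) (hrp.trans (hrR₁.trans_le hx.1)))
  have hVc : Continuous V :=
    continuous_finsetSum _ fun μ _ ↦
      ((hχ1.continuous_fderiv one_ne_zero).clm_apply continuous_const).abs
  have hVz : ∀ x, x ∉ Ksh → V x = 0 := by
    intro x hx
    refine Finset.sum_eq_zero fun μ _ ↦ ?_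
    by_contra hne
    exact hx ((hL x μ).2 (fun h0 ↦ hne (by rw [h0, abs_zero])))
  have hec : Continuous e :=
    continuous_const.mul (continuous_iff_continuousAt.mpr fun x ↦
      continuousAt_weight_mul hKshc hKshU hVc hVz hp2c x)
  have he0 : ∀ x, 0 ≤ e x := fun x ↦ mul_nonneg (by positivity) (mul_nonneg (hV0 x) (hp2nn x))
  -- spatial bound on `K`
  have hρK : ∀ x ∈ K, F (E4.spatial x) ≤ x 0 → x 0 ≤ s + F (E4.spatial x) →
      E4.spatialNorm x ≤ ρ := fun x hx _ _ ↦
    spatialNorm_le_of_mem_redShiftWeightSet hrp hε hx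
  -- ### pointwise bounds on the currents at the points of `K`
  have hΞK : ∀ x ∈ K, ∀ α, |N x α| ≤ Ξ := fun x hx α ↦ hΞ x (hKr x hx).le (hKR₂ x hx) α
  have hCurK : ∀ x ∈ K, ∀ μ, |Cur μ x| ≤ CJ * p2 x := by
    intro x hx μ
    have h1 : |JN μ x| ≤ 6 * (1 + B.bound) * Ξ * p2 x :=
      B.abs_multiplierCurrent_le Φ x (hΞK x hx) μ
    have h2 : |P μ x| ≤ 6 * (1 + B.bound) ^ 2 * p2 x := B.abs_normalCurrent_le Φ x μ
    have h3 : |ε₀ * P μ x| ≤ 6 * (1 + B.bound) ^ 2 * p2 x := by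
      rw [abs_mul, abs_of_pos hε₀pos]
      calc ε₀ * |P μ x| ≤ 1 * |P μ x| := mul_le_mul_of_nonneg_right hε₀le1 (abs_nonneg _)
        _ ≤ 6 * (1 + B.bound) ^ 2 * p2 x := by rw [one_mul]; exact h2
    calc |Cur μ x| = |-JN μ x + ε₀ * P μ x| := rfl
      _ ≤ |-JN μ x| + |ε₀ * P μ x| := abs_add_le _ _
      _ ≤ 6 * (1 + B.bound) * Ξ * p2 x + 6 * (1 + B.bound) ^ 2 * p2 x := by
          rw [abs_neg]; exact add_le_add h1 h3
      _ = CJ * p2 x := by rw [hCJ]; ring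
  -- collar facts at the points of `K`
  have hcolK : ∀ x ∈ K,
      bilin M a x (redShiftVec M a hp hp x) (redShiftVec M a hp hp x) < 0 ∧
        0 ≤ redShiftVec M a hp hp x 0 ∧
        ∀ n' ∈ admissibleConormals, 0 < ∑ μ, n' μ * N x μ := by
    intro x hx
    obtain ⟨h1, h2, h3⟩ := hcol x ((hKabs x hx).trans hηle₂)
    refine ⟨by linarith, by linarith, fun n' hn' ↦ ?_⟩
    have h4 := h3 n' hn'
    simp only [redShiftVec_apply] at h4
    exact lt_of_lt_of_le hb₂ h4
  have hnadm : ∀ x, n x ∈ admissibleConormals := fun x ↦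
    graphConormal_mem_admissibleConormals ((hFc (E4.spatial x)).trans (by nlinarith))
  -- ### the leaf flux: lower and upper bounds
  have hfluxW : ∀ x, ∑ μ, J μ x * n x μ = W x * ∑ μ, Cur μ x * n x μ := by
    intro x
    simp only [hJ, Finset.mul_sum]
    exact Finset.sum_congr rfl fun μ _ ↦ by ring
  have hqlow : ∀ x, A * c * (W x * p2 x) ≤ ∑ μ, J μ x * n x μ := by
    intro x
    rw [hfluxW x]
    by_cases hWx : W x = 0
    · simp only [hWx, zero_mul, mul_zero, le_refl]
    have hxK : x ∈ K := hWK x hWx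
    have hxr := hKr x hxK
    obtain ⟨hNN, -, hco⟩ := hcolK x hxK
    have h1 : 0 ≤ -∑ μ, JN μ x * n x μ :=
      neg_sum_redShiftCurrent_mul_nonneg hMa hxr hNN (hnadm x) (hco _ (hnadm x)) Φ
    have h2 : c * P 0 x ≤ ∑ μ, n x μ * P μ x :=
      B.mul_normalCurrent_zero_le_graphFlux Φ x hc hc1 (hFc (E4.spatial x))
    have h3 : p2 x ≤ 6 * P 0 x := B.sum_sq_le_six_mul_normalCurrent_zero Φ x
    have hsplit : ∑ μ, Cur μ x * n x μ = -∑ μ, JN μ x * n x μ + ε₀ * ∑ μ, n x μ * P μ x := by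
      simp only [hCur, Finset.mul_sum, ← Finset.sum_neg_distrib, ← Finset.sum_add_distrib]
      exact Finset.sum_congr rfl fun μ _ ↦ by ring
    rw [hsplit]
    have h4 : A * c * p2 x ≤ ε₀ * (c * P 0 x) := by
      calc A * c * p2 x ≤ ε₀ / 6 * c * (6 * P 0 x) := by gcongr
        _ = ε₀ * (c * P 0 x) := by ring
    have h5 : ε₀ * (c * P 0 x) ≤ ε₀ * ∑ μ, n x μ * P μ x := mul_le_mul_of_nonneg_left h2 hε₀pos.le
    have hWx0 : 0 ≤ W x := hW0 x
    calc A * c * (W x * p2 x) = W x * (A * c * p2 x) := by ring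
      _ ≤ W x * (-∑ μ, JN μ x * n x μ + ε₀ * ∑ μ, n x μ * P μ x) :=
          mul_le_mul_of_nonneg_left (by linarith) hWx0
  have hqup : ∀ x, ∑ μ, J μ x * n x μ ≤ 4 * CJ * (W x * p2 x) := by
    intro x
    rw [hfluxW x]
    by_cases hWx : W x = 0
    · simp only [hWx, zero_mul, mul_zero, le_refl]
    have hxK : x ∈ K := hWK x hWx
    have h1 : ∑ μ, Cur μ x * n x μ ≤ ∑ _μ : Fin 4, CJ * p2 x := by
      refine Finset.sum_le_sum fun μ _ ↦ ?_
      have ha := abs_apply_le_one_of_mem_admissibleConormals (hnadm x) μ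
      have hb := hCurK x hxK μ
      calc Cur μ x * n x μ ≤ |Cur μ x * n x μ| := le_abs_self _
        _ = |Cur μ x| * |n x μ| := abs_mul _ _
        _ ≤ CJ * p2 x * 1 := mul_le_mul hb ha (abs_nonneg _) (by positivity)
        _ = CJ * p2 x := mul_one _
    have h2 : ∑ _μ : Fin 4, CJ * p2 x = 4 * (CJ * p2 x) := by
      simp only [Finset.sum_const, Finset.card_univ, Fintype.card_fin, nsmul_eq_mul, Nat.cast_ofNat]
    calc W x * ∑ μ, Cur μ x * n x μ ≤ W x * (4 * (CJ * p2 x)) :=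
          mul_le_mul_of_nonneg_left (h1.trans h2.le) (hW0 x)
      _ = 4 * CJ * (W x * p2 x) := by ring
  -- ### the divergence of the weighted current at the points of `K`
  have hdiv : ∀ x ∈ K, F (E4.spatial x) ≤ x 0 → x 0 ≤ s + F (E4.spatial x) →
      ∑ μ, fderiv ℝ (J μ) x (E4.basisVector μ) ≤ -ℓ x + e x := by
    intro x hxK _ _
    have hxU : x ∈ U := hKU hxK
    have hxr : rPlus M a < radius a x := hKr x hxK
    have hxpos : 0 < radius a x := hUpos x hxU
    -- differentiability
    have hWd : DifferentiableAt ℝ W x := (hW1.differentiable one_ne_zero) x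
    have hχd : DifferentiableAt ℝ χ x := (hχ1.differentiable one_ne_zero) x
    have hhfd : DifferentiableAt ℝ hf x := (hhf1.differentiable one_ne_zero) x
    have hJNd : ∀ μ, DifferentiableAt ℝ (JN μ) x := fun μ ↦
      (hJN1 μ x hxU).differentiableAt one_ne_zero
    have hPd : ∀ μ, DifferentiableAt ℝ (P μ) x := fun μ ↦
      (hP1 μ x hxU).differentiableAt one_ne_zero
    have hCurd : ∀ μ, DifferentiableAt ℝ (Cur μ) x := fun μ ↦
      (hCur1 μ x hxU).differentiableAt one_ne_zero
    -- product rules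
    have hdW : ∀ κ, fderiv ℝ W x (E4.basisVector κ) =
        fderiv ℝ χ x (E4.basisVector κ) * hf x + χ x * fderiv ℝ hf x (E4.basisVector κ) := by
      intro κ
      have : W = fun y ↦ χ y * hf y := rfl
      rw [this, fderiv_fun_mul hχd hhfd]
      simp only [add_apply, FunLike.coe_smul, Pi.smul_apply, smul_eq_mul]
      ring
    have hdJ : ∀ μ κ, fderiv ℝ (J μ) x (E4.basisVector κ) =
        fderiv ℝ W x (E4.basisVector κ) * Cur μ x + W x * fderiv ℝ (Cur μ) x (E4.basisVector κ) := by
      intro μ κ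
      have : J μ = fun y ↦ W y * Cur μ y := rfl
      rw [this, fderiv_fun_mul hWd (hCurd μ)]
      simp only [add_apply, FunLike.coe_smul, Pi.smul_apply, smul_eq_mul]
      ring
    have hdCur : ∀ μ κ, fderiv ℝ (Cur μ) x (E4.basisVector κ) =
        -fderiv ℝ (JN μ) x (E4.basisVector κ) + ε₀ * fderiv ℝ (P μ) x (E4.basisVector κ) := by
      intro μ κ
      have h1 : DifferentiableAt ℝ (fun y ↦ -JN μ y) x := (hJNd μ).neg
      have h2 : DifferentiableAt ℝ (fun y ↦ ε₀ * P μ y) x := (hPd μ).const_mul ε₀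
      have : Cur μ = fun y ↦ -JN μ y + ε₀ * P μ y := rfl
      rw [this, fderiv_fun_add h1 h2, fderiv_fun_neg, fderiv_const_mul (hPd μ)]
      simp only [add_apply, neg_apply, FunLike.coe_smul, Pi.smul_apply, smul_eq_mul]
    -- the divergences of `J^N` and `J^{dt*}`
    have hdivN : ∑ μ, fderiv ℝ (JN μ) x (E4.basisVector μ) =
        KerrSchild.multiplierBulk (inverseMetric M a) N Φ x :=
      sum_fderiv_redShiftCurrent hMa hp hp (hΦ x hxU) hxr (hsol x hxU)
    have hdivP : ∑ μ, fderiv ℝ (P μ) x (E4.basisVector μ) = KerrSchild.deformationTerm G Φ x := by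
      have h := KerrSchild.sum_fderiv_normalCurrent (B.differentiableAt_inverseMetric x)
        (B.inverseMetric_symm x) (hΦ x hxU)
      rw [hsol x hxU, zero_mul, zero_add] at h
      exact h
    -- assemble the divergence, term by term
    have hterm : ∀ μ, fderiv ℝ (J μ) x (E4.basisVector μ) =
        hf x * (fderiv ℝ χ x (E4.basisVector μ) * Cur μ x) +
          χ x * (-(fderiv ℝ hf x (E4.basisVector μ) * JN μ x) +
            ε₀ * (fderiv ℝ hf x (E4.basisVector μ) * P μ x)) +
          W x * (-fderiv ℝ (JN μ) x (E4.basisVector μ) +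
            ε₀ * fderiv ℝ (P μ) x (E4.basisVector μ)) := by
      intro μ
      rw [hdJ, hdW, hdCur, hWdef]
      simp only [hCur]
      ring
    have hS2 : ∑ μ, (-(fderiv ℝ hf x (E4.basisVector μ) * JN μ x) +
        ε₀ * (fderiv ℝ hf x (E4.basisVector μ) * P μ x)) =
        -(∑ μ, fderiv ℝ hf x (E4.basisVector μ) * JN μ x) +
          ε₀ * ∑ μ, fderiv ℝ hf x (E4.basisVector μ) * P μ x := by
      rw [Finset.sum_add_distrib, Finset.sum_neg_distrib, ← Finset.mul_sum]
    have hS3 : ∑ μ, (-fderiv ℝ (JN μ) x (E4.basisVector μ) +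
        ε₀ * fderiv ℝ (P μ) x (E4.basisVector μ)) =
        -KerrSchild.multiplierBulk (inverseMetric M a) N Φ x +
          ε₀ * KerrSchild.deformationTerm G Φ x := by
      rw [Finset.sum_add_distrib, Finset.sum_neg_distrib, ← Finset.mul_sum, hdivN, hdivP]
    have hsum : ∑ μ, fderiv ℝ (J μ) x (E4.basisVector μ) =
        hf x * ∑ μ, fderiv ℝ χ x (E4.basisVector μ) * Cur μ x +
          χ x * (-(∑ μ, fderiv ℝ hf x (E4.basisVector μ) * JN μ x) +
            ε₀ * ∑ μ, fderiv ℝ hf x (E4.basisVector μ) * P μ x) +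
          W x * (-KerrSchild.multiplierBulk (inverseMetric M a) N Φ x +
            ε₀ * KerrSchild.deformationTerm G Φ x) := by
      rw [Finset.sum_congr rfl fun μ _ ↦ hterm μ, Finset.sum_add_distrib, Finset.sum_add_distrib,
        ← Finset.mul_sum, ← Finset.mul_sum, ← Finset.mul_sum, hS2, hS3]
    rw [hsum]
    -- (i) the inner-boundary fluxes have signs
    obtain ⟨hNN, hN0, -⟩ := hcolK x hxK
    have hβ : 0 < 1 + hp * (radius a x - rPlus M a) := by
      have : 0 ≤ hp * (radius a x - rPlus M a) := mul_nonneg hp0.le (by linarith)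
      linarith
    have hi1 : 0 ≤ ∑ μ, fderiv ℝ hf x (E4.basisVector μ) * JN μ x :=
      redShift_horizonFactor_flux hMa Φ hε hxr hNN hN0 hβ
    have hi2 : ∑ μ, fderiv ℝ hf x (E4.basisVector μ) * P μ x ≤ 0 :=
      horizonFactor_flux hMa Φ hε hxr
    have hi : χ x * (-(∑ μ, fderiv ℝ hf x (E4.basisVector μ) * JN μ x) +
        ε₀ * ∑ μ, fderiv ℝ hf x (E4.basisVector μ) * P μ x) ≤ 0 := by
      refine mul_nonpos_iff.mpr (Or.inl ⟨hχ0 x, ?_⟩)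
      have := mul_nonpos_iff.mpr (Or.inl ⟨hε₀pos.le, hi2⟩)
      linarith
    -- (ii) the cut-off error
    have hii : hf x * ∑ μ, fderiv ℝ χ x (E4.basisVector μ) * Cur μ x ≤ e x := by
      have h1 : |∑ μ, fderiv ℝ χ x (E4.basisVector μ) * Cur μ x| ≤ CJ * (V x * p2 x) := by
        calc |∑ μ, fderiv ℝ χ x (E4.basisVector μ) * Cur μ x|
            ≤ ∑ μ, |fderiv ℝ χ x (E4.basisVector μ) * Cur μ x| := Finset.abs_sum_le_sum_abs _ _
          _ ≤ ∑ μ, |fderiv ℝ χ x (E4.basisVector μ)| * (CJ * p2 x) := by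
              refine Finset.sum_le_sum fun μ _ ↦ ?_
              rw [abs_mul]
              exact mul_le_mul_of_nonneg_left (hCurK x hxK μ) (abs_nonneg _)
          _ = CJ * (V x * p2 x) := by rw [hV, ← Finset.sum_mul]; ring
      have h2 : hf x * ∑ μ, fderiv ℝ χ x (E4.basisVector μ) * Cur μ x ≤
          |∑ μ, fderiv ℝ χ x (E4.basisVector μ) * Cur μ x| :=
        (mul_le_mul_of_nonneg_left (le_abs_self _) (hhf0 x)).trans
          (mul_le_of_le_one_left (abs_nonneg _) (hhfle x))
      have h3 : CJ * (V x * p2 x) ≤ e x := by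
        have h0 : 0 ≤ CJ * (V x * p2 x) := mul_nonneg hCJ0 (mul_nonneg (hV0 x) (hp2nn x))
        show CJ * (V x * p2 x) ≤ 4 * CJ * (V x * p2 x)
        linarith only [h0]
      exact h2.trans (h1.trans h3)
    -- (iii) the bulk: coercivity of `K^N` and smallness of `ε₀ R`
    have hiii : W x * (-KerrSchild.multiplierBulk (inverseMetric M a) N Φ x +
        ε₀ * KerrSchild.deformationTerm G Φ x) ≤ -ℓ x := by
      have h1 : b₁ * p2 x ≤ KerrSchild.multiplierBulk (inverseMetric M a) N Φ x :=
        hcoer x ((hKabs x hxK).trans hηle₁) Φ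
      have h2 : |KerrSchild.deformationTerm G Φ x| ≤ 32 * (1 + B.bound) * D * p2 x :=
        B.abs_deformationTerm_le Φ x hD0 (fun μ α β ↦ hD x μ α β)
      have h3 : ε₀ * KerrSchild.deformationTerm G Φ x ≤ b₁ / 2 * p2 x := by
        calc ε₀ * KerrSchild.deformationTerm G Φ x ≤ ε₀ * (32 * (1 + B.bound) * D * p2 x) :=
              mul_le_mul_of_nonneg_left ((le_abs_self _).trans h2) hε₀pos.le
          _ = ε₀ * (32 * (1 + B.bound) * D) * p2 x := by ring
          _ ≤ b₁ / 2 * p2 x := mul_le_mul_of_nonneg_right hε₀D (hp2nn x)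
      have h4 : -KerrSchild.multiplierBulk (inverseMetric M a) N Φ x +
          ε₀ * KerrSchild.deformationTerm G Φ x ≤ -(b₁ / 2 * p2 x) := by linarith
      calc W x * (-KerrSchild.multiplierBulk (inverseMetric M a) N Φ x +
            ε₀ * KerrSchild.deformationTerm G Φ x) ≤ W x * (-(b₁ / 2 * p2 x)) :=
            mul_le_mul_of_nonneg_left h4 (hW0 x)
        _ = -ℓ x := by simp only [hℓ]; ring
    linarith only [hi, hii, hiii]
  -- ### the energy inequality along the graph foliation
  have hmain := E4.graphFlux_add_integral_le_of_divergence_le hKc hJ1 hJ0 hF hρK hℓc hec hℓK he0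
    hdiv hs le_rfl
  -- ### comparison of the four integrals
  have hgraph : ∀ t : ℝ, Continuous fun y : E3 ↦ E4.ofTimeSpace (t + F y) y := fun t ↦
    E4.continuous_ofTimeSpace' (continuous_const.add hF.continuous) continuous_id
  have hF1 : ContDiff ℝ 1 F := hF.of_le one_le_two
  have hnc : ∀ μ, Continuous fun y : E3 ↦ graphConormal F y μ := by
    intro μ
    refine Fin.cases ?_ (fun i ↦ ?_) μ
    · simp only [graphConormal_zero]; exact continuous_const
    · simp only [graphConormal_succ, partialE3]
      exact ((hF1.continuous_fderiv one_ne_zero).clm_apply continuous_const).neg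
  -- the weighted density `W ∑(∂Φ)²` is continuous on `ℝ⁴`
  have hWp2c : Continuous fun x ↦ W x * p2 x :=
    continuous_iff_continuousAt.mpr fun x ↦ continuousAt_weight_mul hKc hKU hW1.continuous hWz hp2c x
  have hVp2c : Continuous fun x ↦ V x * p2 x :=
    continuous_iff_continuousAt.mpr fun x ↦ continuousAt_weight_mul hKshc hKshU hVc hVz hp2c x
  have hfluxc : ∀ t, Continuous fun y : E3 ↦
      ∑ μ, J μ (E4.ofTimeSpace (t + F y) y) * graphConormal F y μ := fun t ↦
    continuous_finsetSum _ fun μ _ ↦ ((hJ1 μ).continuous.comp (hgraph t)).mul (hnc μ)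
  have hint : ∀ (g : E4 → ℝ), Continuous g → ∀ t,
      IntegrableOn (fun y : E3 ↦ g (E4.ofTimeSpace (t + F y) y)) (closedBall (0 : E3) ρ) :=
    fun g hg t ↦ (hg.comp (hgraph t)).continuousOn.integrableOn_compact (isCompact_closedBall _ _)
  -- (a) the flux at time `s` from below
  have ha : A * c * (∫ y in closedBall (0 : E3) ρ, W (E4.ofTimeSpace (s + F y) y) *
      p2 (E4.ofTimeSpace (s + F y) y)) ≤
      ∫ y in closedBall (0 : E3) ρ, ∑ μ, J μ (E4.ofTimeSpace (s + F y) y) * graphConormal F y μ := by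
    rw [← integral_const_mul]
    refine setIntegral_mono_on ((hint _ hWp2c s).const_mul _)
      ((hfluxc s).continuousOn.integrableOn_compact (isCompact_closedBall _ _))
      measurableSet_closedBall fun y _ ↦ ?_
    have h := hqlow (E4.ofTimeSpace (s + F y) y)
    simp only [hn, E4.spatial_ofTimeSpace] at h
    exact h
  -- (b) the flux at time `0` from above
  have hb : (∫ y in closedBall (0 : E3) ρ, ∑ μ, J μ (E4.ofTimeSpace (0 + F y) y) *
      graphConormal F y μ) ≤ 4 * CJ * ∫ y in closedBall (0 : E3) ρ,
        W (E4.ofTimeSpace (0 + F y) y) * p2 (E4.ofTimeSpace (0 + F y) y) := by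
    rw [← integral_const_mul]
    refine setIntegral_mono_on
      ((hfluxc 0).continuousOn.integrableOn_compact (isCompact_closedBall _ _))
      ((hint _ hWp2c 0).const_mul _) measurableSet_closedBall fun y _ ↦ ?_
    have h := hqup (E4.ofTimeSpace (0 + F y) y)
    simp only [hn, E4.spatial_ofTimeSpace] at h
    exact h
  -- (c) the bulk integrals
  have hcℓ : (∫ u in Set.Ioc 0 s, ∫ y in closedBall (0 : E3) ρ, ℓ (E4.ofTimeSpace (u + F y) y)) =
      b₁ / 2 * ∫ u in Set.Ioc 0 s, ∫ y in closedBall (0 : E3) ρ,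
        W (E4.ofTimeSpace (u + F y) y) * p2 (E4.ofTimeSpace (u + F y) y) := by
    simp only [hℓ, integral_const_mul]
  have hce : (∫ u in Set.Ioc 0 s, ∫ y in closedBall (0 : E3) ρ, e (E4.ofTimeSpace (u + F y) y)) =
      4 * CJ * ∫ u in Set.Ioc 0 s, ∫ y in closedBall (0 : E3) ρ,
        V (E4.ofTimeSpace (u + F y) y) * p2 (E4.ofTimeSpace (u + F y) y) := by
    simp only [he, integral_const_mul]
  have hYnn : 0 ≤ ∫ u in Set.Ioc 0 s, ∫ y in closedBall (0 : E3) ρ,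
      W (E4.ofTimeSpace (u + F y) y) * p2 (E4.ofTimeSpace (u + F y) y) :=
    setIntegral_nonneg measurableSet_Ioc fun u _ ↦
      setIntegral_nonneg measurableSet_closedBall fun y _ ↦ mul_nonneg (hW0 _) (hp2nn _)
  have hcA : A * (∫ u in Set.Ioc 0 s, ∫ y in closedBall (0 : E3) ρ,
      W (E4.ofTimeSpace (u + F y) y) * p2 (E4.ofTimeSpace (u + F y) y)) ≤
      ∫ u in Set.Ioc 0 s, ∫ y in closedBall (0 : E3) ρ, ℓ (E4.ofTimeSpace (u + F y) y) := by
    rw [hcℓ]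
    exact mul_le_mul_of_nonneg_right hAb hYnn
  -- ### conclusion
  have hfin := add_le_add ha hcA
  have hfin' := add_le_add_right hb
    (∫ u in Set.Ioc 0 s, ∫ y in closedBall (0 : E3) ρ, e (E4.ofTimeSpace (u + F y) y))
  rw [hce] at hfin' hmain
  simp only [hp2] at hfin hfin' hmain ⊢
  linarith

end Kerr

/-! ## Part 6. The red-shift estimate between graph leaves: the limit `ε → 0` -/

namespace Kerr

variable {M a : ℝ} {x : E4}

/-- `W_ε = 1` where `u₂ ≥ 2ε` and `r ≤ R₁` (`R₁ < R₂`, `ε > 0`). [folklore] -/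
theorem redShiftWeight_eq_one {M a R₁ R₂ ε : ℝ} (hR : R₁ < R₂) (hε : 0 < ε)
    (h2 : 2 * ε ≤ horizonFn M a x) (hr : radius a x ≤ R₁) : redShiftWeight M a R₁ R₂ ε x = 1 := by
  rw [redShiftWeight, collarCutoff_eq_one hR hr, one_mul]
  refine Real.smoothTransition.one_of_one_le ?_
  rw [le_sub_iff_add_le, le_div_iff₀ hε]
  linarith

/-- **The red-shift estimate between admissible graph leaves** (Dafermos–Rodnianski–
Shlapentokh-Rothman arXiv:1402.7034, Prop. 4.5.2 with the zeroth order terms removed, in the form of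
the first display (boundedEnergyHorizon) of §13.2; Dafermos–Rodnianski arXiv:0811.0354, §3.3.3 and
Thm. 7.1). For subextremal `(M, a)` there is `η₀ > 0` such that for every collar width
`0 < η ≤ η₀` there is `C > 0` such that for every `C²` height
`F` of slope `‖dF‖ ≤ 1 − c` (`0 < c ≤ 1`), every `Φ : ℝ⁴ → ℝ` of class `C²` on the exterior
`{r > r₊}` of the ingoing Kerr–Schild chart solving the Kerr wave equation there, and every `s ≥ 0`,
with `Σ̃_u = {(u + F(y), y)}` the graph leaves and `e[Φ] = ∑_μ (∂_μΦ)²`,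
`∫_{Σ̃_s ∩ {r₊ < r ≤ r₊ + η/2}} e[Φ] dy + ∫_0^s ∫_{Σ̃_u ∩ {r₊ < r ≤ r₊ + η/2}} e[Φ] dy du
  ≤ (C/c) (∫_{Σ̃_0 ∩ {r₊ < r ≤ r₊ + η}} e[Φ] dy + ∫_0^s ∫_{Σ̃_u ∩ {r₊ + η/2 ≤ r ≤ r₊ + η}} e[Φ] dy du)`
in `[0, ∞]`: the energy near the horizon at time `s` and the red-shift bulk are controlled by the
initial energy near the horizon and the space-time integral of the energy density over the cut-off
shell, where the bulk of `N` has no sign. Proof: `Kerr.redShift_weighted_estimate` at receding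
parameter `ε = 1/(n+1)` (the weight is `1` on `{u₂ ≥ 2ε, r ≤ r₊ + η/2}`, `≤ 1_{r₊ < r ≤ r₊ + η}`,
and `∑|∂χ| ≤ 4L` is supported in the shell), written with Lebesgue integrals, and exhaustion of
`{r > r₊}` by `{u₂ ≥ 2/(n+1)}` (monotone convergence in `y` and in `u`).
[cite: DafermosRodnianskiShlapentokhrothman2014, Prop. 4.5.2 and §13.2] -/
theorem redShift_estimate (hMa : IsSubextremal M a) :
    ∃ η₀ : ℝ, 0 < η₀ ∧ ∀ η : ℝ, 0 < η → η ≤ η₀ → ∃ C : ℝ, 0 < C ∧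
      ∀ (F : E3 → ℝ) (c : ℝ), ContDiff ℝ 2 F → 0 < c → c ≤ 1 →
      (∀ y, ‖fderiv ℝ F y‖ ≤ 1 - c) →
      ∀ Φ : E4 → ℝ,
      (∀ x ∈ (exterior M a : Set E4), ContDiffAt ℝ 2 Φ x) →
      (∀ x ∈ (exterior M a : Set E4),
        KerrSchild.waveOperator
          (KerrSchild.inverseMetric (fun y ↦ 2 * scalarH M a y) (nullVector a)) Φ x = 0) →
      ∀ s : ℝ, 0 ≤ s →
        (∫⁻ y, {y : E3 | rPlus M a < radius a (E4.ofTimeSpace (s + F y) y) ∧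
              radius a (E4.ofTimeSpace (s + F y) y) ≤ rPlus M a + η / 2}.indicator
            (fun y ↦ ENNReal.ofReal
              (∑ μ, fderiv ℝ Φ (E4.ofTimeSpace (s + F y) y) (E4.basisVector μ) ^ 2)) y) +
          ∫⁻ u in Set.Ioc 0 s, ∫⁻ y,
            {y : E3 | rPlus M a < radius a (E4.ofTimeSpace (u + F y) y) ∧
              radius a (E4.ofTimeSpace (u + F y) y) ≤ rPlus M a + η / 2}.indicator
            (fun y ↦ ENNReal.ofReal
              (∑ μ, fderiv ℝ Φ (E4.ofTimeSpace (u + F y) y) (E4.basisVector μ) ^ 2)) y ≤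
        ENNReal.ofReal (C / c) *
          ((∫⁻ y, {y : E3 | rPlus M a < radius a (E4.ofTimeSpace (0 + F y) y) ∧
                radius a (E4.ofTimeSpace (0 + F y) y) ≤ rPlus M a + η}.indicator
              (fun y ↦ ENNReal.ofReal
                (∑ μ, fderiv ℝ Φ (E4.ofTimeSpace (0 + F y) y) (E4.basisVector μ) ^ 2)) y) +
            ∫⁻ u in Set.Ioc 0 s, ∫⁻ y,
              {y : E3 | rPlus M a + η / 2 ≤ radius a (E4.ofTimeSpace (u + F y) y) ∧
                radius a (E4.ofTimeSpace (u + F y) y) ≤ rPlus M a + η}.indicator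
              (fun y ↦ ENNReal.ofReal
                (∑ μ, fderiv ℝ Φ (E4.ofTimeSpace (u + F y) y) (E4.basisVector μ) ^ 2)) y) := by
  obtain ⟨η₀, hη₀, hest₀⟩ := redShift_weighted_estimate hMa
  refine ⟨η₀, hη₀, fun η hη hηle ↦ ?_⟩
  obtain ⟨A, C, hA, hC0, hest⟩ := hest₀ η hη hηle
  have hrp : 0 < rPlus M a := hMa.rPlus_pos
  set R₁ : ℝ := rPlus M a + η / 2 with hR₁
  set R₂ : ℝ := rPlus M a + η with hR₂
  have hR₁pos : 0 < R₁ := by positivity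
  have hR12 : R₁ < R₂ := by rw [hR₁, hR₂]; linarith
  have hrR₁ : rPlus M a < R₁ := by rw [hR₁]; linarith
  obtain ⟨L, hL0, hL⟩ := exists_abs_fderiv_collarCutoff_le (a := a) hR₁pos hR12
  have hC1 : 0 < C + 1 := by linarith
  set C₆ : ℝ := (C + 1) / A * (1 + 4 * L) with hC₆
  have hC₆pos : 0 < C₆ := mul_pos (div_pos hC1 hA) (by linarith)
  refine ⟨C₆, hC₆pos, fun F c hF hc hc1 hslope Φ hΦ hsol s hs ↦ ?_⟩
  -- ### the equation on the surgered background; the slope of `F`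
  set B := surgeryBackground M a (rPlus M a) hMa.pos.le hMa.rPlus_pos with hB
  have hsolB : ∀ x ∈ (exterior M a : Set E4),
      KerrSchild.waveOperator B.inverseMetric Φ x = 0 := by
    intro x hx
    rw [← KerrSchild.waveOperator_congr_of_eventuallyEq
      (surgeryBackground_inverseMetric_eventuallyEq M a hMa.pos.le hMa.rPlus_pos ⟨x, hx⟩) Φ]
    exact hsol x hx
  have hFc : ∀ y, ∑ i, partialE3 F y i ^ 2 ≤ (1 - c) ^ 2 := fun y ↦
    (sum_sq_partialE3_le F y).trans (pow_le_pow_left₀ (norm_nonneg _) (hslope y) 2)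
  -- ### notation
  set ρ : ℝ := √(R₂ ^ 2 + a ^ 2) with hρ
  set χ : E4 → ℝ := collarCutoff a R₁ R₂ with hχ
  set V : E4 → ℝ := fun x ↦ ∑ μ, |fderiv ℝ χ x (E4.basisVector μ)| with hV
  set p2 : E4 → ℝ := fun x ↦ ∑ μ, fderiv ℝ Φ x (E4.basisVector μ) ^ 2 with hp2
  set fd : ℝ → E3 → ℝ≥0∞ := fun t y ↦
    ENNReal.ofReal (∑ μ, fderiv ℝ Φ (E4.ofTimeSpace (t + F y) y) (E4.basisVector μ) ^ 2) with hfd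
  set T : ℝ → ℝ → Set E3 := fun R t ↦ {y | rPlus M a < radius a (E4.ofTimeSpace (t + F y) y) ∧
    radius a (E4.ofTimeSpace (t + F y) y) ≤ R} with hT
  set Sh : ℝ → Set E3 := fun t ↦ {y | R₁ ≤ radius a (E4.ofTimeSpace (t + F y) y) ∧
    radius a (E4.ofTimeSpace (t + F y) y) ≤ R₂} with hSh
  set S : ℕ → ℝ → Set E3 := fun n t ↦
    {y | 2 * (1 / ((n : ℝ) + 1)) ≤ horizonFn M a (E4.ofTimeSpace (t + F y) y) ∧
      radius a (E4.ofTimeSpace (t + F y) y) ≤ R₁} with hS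
  set E0 : ℝ≥0∞ := ∫⁻ y, (T R₂ 0).indicator (fd 0) y with hE0
  set ShI : ℝ≥0∞ := ∫⁻ u in Set.Ioc 0 s, ∫⁻ y, (Sh u).indicator (fd u) y with hShI
  show (∫⁻ y, (T R₁ s).indicator (fd s) y) + ∫⁻ u in Set.Ioc 0 s, ∫⁻ y, (T R₁ u).indicator (fd u) y
    ≤ ENNReal.ofReal (C₆ / c) * (E0 + ShI)
  have hmemS : ∀ n t y, y ∈ S n t ↔
      2 * (1 / ((n : ℝ) + 1)) ≤ horizonFn M a (E4.ofTimeSpace (t + F y) y) ∧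
        radius a (E4.ofTimeSpace (t + F y) y) ≤ R₁ := fun _ _ _ ↦ Iff.rfl
  have hmemT : ∀ R t y, y ∈ T R t ↔ rPlus M a < radius a (E4.ofTimeSpace (t + F y) y) ∧
      radius a (E4.ofTimeSpace (t + F y) y) ≤ R := fun _ _ _ ↦ Iff.rfl
  have hmemSh : ∀ t y, y ∈ Sh t ↔ R₁ ≤ radius a (E4.ofTimeSpace (t + F y) y) ∧
      radius a (E4.ofTimeSpace (t + F y) y) ≤ R₂ := fun _ _ ↦ Iff.rfl
  -- ### continuity and measurability
  have hp2nn : ∀ x, 0 ≤ p2 x := fun x ↦ Finset.sum_nonneg fun μ _ ↦ sq_nonneg _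
  have hV0 : ∀ x, 0 ≤ V x := fun x ↦ Finset.sum_nonneg fun μ _ ↦ abs_nonneg _
  have hVle : ∀ x, V x ≤ 4 * L := fun x ↦ by
    calc V x = ∑ μ, |fderiv ℝ χ x (E4.basisVector μ)| := rfl
      _ ≤ ∑ _μ : Fin 4, L := Finset.sum_le_sum fun μ _ ↦ (hL x μ).1
      _ = 4 * L := by
          simp only [Finset.sum_const, Finset.card_univ, Fintype.card_fin, nsmul_eq_mul,
            Nat.cast_ofNat]
  have hgraph : ∀ t : ℝ, Continuous fun y : E3 ↦ E4.ofTimeSpace (t + F y) y := fun t ↦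
    E4.continuous_ofTimeSpace' (continuous_const.add hF.continuous) continuous_id
  have hgraph2 : Continuous fun p : ℝ × E3 ↦ E4.ofTimeSpace (p.1 + F p.2) p.2 :=
    E4.continuous_ofTimeSpace' (continuous_fst.add (hF.continuous.comp continuous_snd))
      continuous_snd
  have hfm : ∀ t, Measurable (fd t) := fun t ↦ measurable_sum_sq_fderiv_graph Φ hF.continuous t
  have hf2m : Measurable fun p : ℝ × E3 ↦
      ENNReal.ofReal (∑ μ, fderiv ℝ Φ (E4.ofTimeSpace (p.1 + F p.2) p.2) (E4.basisVector μ) ^ 2) := by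
    refine ENNReal.measurable_ofReal.comp (Finset.measurable_sum _ fun μ _ ↦ ?_)
    exact ((measurable_fderiv_apply_const ℝ Φ (E4.basisVector μ)).comp hgraph2.measurable).pow_const 2
  have hhc : Continuous (horizonFn M a) := continuous_horizonFn M a
  have hSm : ∀ n t, MeasurableSet (S n t) := fun n t ↦ by
    have h1 : IsClosed {y : E3 | 2 * (1 / ((n : ℝ) + 1)) ≤
        horizonFn M a (E4.ofTimeSpace (t + F y) y)} :=
      isClosed_le continuous_const (hhc.comp (hgraph t))
    have h2 : IsClosed {y : E3 | radius a (E4.ofTimeSpace (t + F y) y) ≤ R₁} :=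
      isClosed_le ((continuous_radius a).comp (hgraph t)) continuous_const
    have h3 : S n t = {y : E3 | 2 * (1 / ((n : ℝ) + 1)) ≤
        horizonFn M a (E4.ofTimeSpace (t + F y) y)} ∩
        {y : E3 | radius a (E4.ofTimeSpace (t + F y) y) ≤ R₁} := by
      ext y; simp only [hmemS, Set.mem_inter_iff, Set.mem_setOf_eq]
    rw [h3]
    exact (h1.inter h2).measurableSet
  have hS2c : ∀ n : ℕ, IsClosed ({p : ℝ × E3 | 2 * (1 / ((n : ℝ) + 1)) ≤
      horizonFn M a (E4.ofTimeSpace (p.1 + F p.2) p.2)} ∩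
      {p : ℝ × E3 | radius a (E4.ofTimeSpace (p.1 + F p.2) p.2) ≤ R₁}) := fun n ↦
    (isClosed_le continuous_const (hhc.comp hgraph2)).inter
      (isClosed_le ((continuous_radius a).comp hgraph2) continuous_const)
  have hGm : ∀ n, Measurable fun u ↦ ∫⁻ y, (S n u).indicator (fd u) y := by
    intro n
    have hm := (hf2m.indicator (hS2c n).measurableSet).lintegral_prod_right' (ν := volume)
    have heq : (fun u ↦ ∫⁻ y, (S n u).indicator (fd u) y) = fun u : ℝ ↦ ∫⁻ y : E3,
        ({p : ℝ × E3 | 2 * (1 / ((n : ℝ) + 1)) ≤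
            horizonFn M a (E4.ofTimeSpace (p.1 + F p.2) p.2)} ∩
          {p : ℝ × E3 | radius a (E4.ofTimeSpace (p.1 + F p.2) p.2) ≤ R₁}).indicator
          (fun p : ℝ × E3 ↦ ENNReal.ofReal
            (∑ μ, fderiv ℝ Φ (E4.ofTimeSpace (p.1 + F p.2) p.2) (E4.basisVector μ) ^ 2))
          (u, y) := by
      funext u
      refine lintegral_congr fun y ↦ ?_
      simp only [Set.indicator_apply, hmemS, Set.mem_inter_iff, Set.mem_setOf_eq, hfd]
    rw [heq]
    exact hm
  -- continuity of the densities on `ℝ⁴`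
  have hp2c : ∀ x ∈ (exterior M a : Set E4), ContinuousAt p2 x := by
    intro x hx
    have h2 : ContDiffAt ℝ ((1 : ℕ∞) + 1 : ℕ∞) Φ x := by exact_mod_cast hΦ x hx
    exact tendsto_finsetSum _ fun ν _ ↦
      (((h2.fderiv_right (m := 1) le_rfl).clm_apply contDiffAt_const).continuousAt).pow 2
  have hχ1 : ContDiff ℝ 1 χ := contDiff_collarCutoff hR₁pos hR12
  set Ksh : Set E4 := {x | R₁ ≤ radius a x ∧ radius a x ≤ R₂} with hKsh
  have hKshc : IsClosed Ksh := by
    rw [hKsh, Set.setOf_and]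
    exact (isClosed_le continuous_const (continuous_radius a)).inter
      (isClosed_le (continuous_radius a) continuous_const)
  have hKshU : Ksh ⊆ (exterior M a : Set E4) := fun x hx ↦
    mem_exterior.2 (max_lt (hrR₁.trans_le hx.1) (hrp.trans (hrR₁.trans_le hx.1)))
  have hVc : Continuous V :=
    continuous_finsetSum _ fun μ _ ↦
      ((hχ1.continuous_fderiv one_ne_zero).clm_apply continuous_const).abs
  have hVz : ∀ x, x ∉ Ksh → V x = 0 := by
    intro x hx
    refine Finset.sum_eq_zero fun μ _ ↦ ?_
    by_contra hne
    exact hx ((hL x μ).2 (fun h0 ↦ hne (by rw [h0, abs_zero])))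
  have hVp2c : Continuous fun x ↦ V x * p2 x :=
    continuous_iff_continuousAt.mpr fun x ↦ continuousAt_weight_mul hKshc hKshU hVc hVz hp2c x
  set Zt : ℝ → ℝ := fun t ↦ ∫ y in closedBall (0 : E3) ρ,
    V (E4.ofTimeSpace (t + F y) y) * p2 (E4.ofTimeSpace (t + F y) y) with hZt
  have hZc : Continuous Zt :=
    continuous_parametric_integral_of_continuous
      (f := fun (t : ℝ) (y : E3) ↦ V (E4.ofTimeSpace (t + F y) y) * p2 (E4.ofTimeSpace (t + F y) y))
      (hVp2c.comp hgraph2) (isCompact_closedBall _ _)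
  have hZnn : ∀ t, 0 ≤ Zt t := fun t ↦
    setIntegral_nonneg measurableSet_closedBall fun y _ ↦ mul_nonneg (hV0 _) (hp2nn _)
  have hZi : ∀ t, IntegrableOn
      (fun y : E3 ↦ V (E4.ofTimeSpace (t + F y) y) * p2 (E4.ofTimeSpace (t + F y) y))
      (closedBall (0 : E3) ρ) := fun t ↦
    (hVp2c.comp (hgraph t)).continuousOn.integrableOn_compact (isCompact_closedBall _ _)
  set Z : ℝ := ∫ u in Set.Ioc 0 s, Zt u with hZ
  have hZnn' : 0 ≤ Z := setIntegral_nonneg measurableSet_Ioc fun u _ ↦ hZnn u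
  -- the error term: `Z ≤ 4L · ShI`
  have herr : ENNReal.ofReal Z ≤ ENNReal.ofReal (4 * L) * ShI := by
    have h1 : ∀ u, ENNReal.ofReal (Zt u) ≤
        ENNReal.ofReal (4 * L) * ∫⁻ y, (Sh u).indicator (fd u) y := by
      intro u
      rw [show Zt u = ∫ y in closedBall (0 : E3) ρ,
          V (E4.ofTimeSpace (u + F y) y) * p2 (E4.ofTimeSpace (u + F y) y) from rfl,
        ofReal_integral_eq_lintegral_ofReal (hZi u)
          (ae_of_all _ fun y ↦ mul_nonneg (hV0 _) (hp2nn _)),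
        ← lintegral_const_mul' _ _ ENNReal.ofReal_ne_top]
      calc ∫⁻ y in closedBall (0 : E3) ρ,
            ENNReal.ofReal (V (E4.ofTimeSpace (u + F y) y) * p2 (E4.ofTimeSpace (u + F y) y))
          ≤ ∫⁻ y in closedBall (0 : E3) ρ, ENNReal.ofReal (4 * L) * (Sh u).indicator (fd u) y := by
            refine lintegral_mono fun y ↦ ?_
            by_cases hy : E4.ofTimeSpace (u + F y) y ∈ Ksh
            · have hyS : y ∈ Sh u := hy
              rw [Set.indicator_of_mem hyS, ← ENNReal.ofReal_mul (by positivity)]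
              exact ENNReal.ofReal_le_ofReal (mul_le_mul_of_nonneg_right (hVle _) (hp2nn _))
            · rw [hVz _ hy, zero_mul, ENNReal.ofReal_zero]
              exact zero_le
        _ ≤ ∫⁻ y, ENNReal.ofReal (4 * L) * (Sh u).indicator (fd u) y :=
            setLIntegral_le_lintegral _ _
    calc ENNReal.ofReal Z = ∫⁻ u in Set.Ioc 0 s, ENNReal.ofReal (Zt u) :=
          ofReal_integral_eq_lintegral_ofReal
            (hZc.integrableOn_Icc.mono_set Set.Ioc_subset_Icc_self) (ae_of_all _ fun u ↦ hZnn u)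
      _ ≤ ∫⁻ u in Set.Ioc 0 s, ENNReal.ofReal (4 * L) * ∫⁻ y, (Sh u).indicator (fd u) y :=
          lintegral_mono fun u ↦ h1 u
      _ = ENNReal.ofReal (4 * L) * ShI := by
          rw [hShI, lintegral_const_mul' _ _ ENNReal.ofReal_ne_top]
  -- ### Step 1: the estimate at receding parameter `ε = 1/(n+1)`
  have hstep : ∀ n : ℕ, (∫⁻ y, (S n s).indicator (fd s) y) +
      ∫⁻ u in Set.Ioc 0 s, ∫⁻ y, (S n u).indicator (fd u) y ≤
        ENNReal.ofReal (C₆ / c) * (E0 + ShI) := by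
    intro n
    set ε : ℝ := 1 / ((n : ℝ) + 1) with hεdef
    have hε : 0 < ε := by positivity
    set W : E4 → ℝ := redShiftWeight M a R₁ R₂ ε with hW
    set K : Set E4 := redShiftWeightSet M a R₂ ε with hK
    have hKc : IsClosed K := isClosed_redShiftWeightSet M a R₂ ε
    have hKU : K ⊆ (exterior M a : Set E4) := redShiftWeightSet_subset_exterior hrp hε
    have hWK : ∀ x, W x ≠ 0 → x ∈ K := fun x hx ↦ mem_redShiftWeightSet_of_ne_zero hR12 hε hx
    have hWz : ∀ x, x ∉ K → W x = 0 := fun x hx ↦ by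
      by_contra h
      exact hx (hWK x h)
    have hW1 : ContDiff ℝ 1 W := contDiff_redShiftWeight hR₁pos hR12 hrp hε
    have hW0 : ∀ x, 0 ≤ W x := redShiftWeight_nonneg M a R₁ R₂ ε
    have hWle : ∀ x, W x ≤ 1 := redShiftWeight_le_one M a R₁ R₂ ε
    have hWp2c : Continuous fun x ↦ W x * p2 x :=
      continuous_iff_continuousAt.mpr fun x ↦
        continuousAt_weight_mul hKc hKU hW1.continuous hWz hp2c x
    -- the real slice integrals of the weighted density
    set Xt : ℝ → ℝ := fun t ↦ ∫ y in closedBall (0 : E3) ρ,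
      W (E4.ofTimeSpace (t + F y) y) * p2 (E4.ofTimeSpace (t + F y) y) with hXt
    have hXc : Continuous Xt :=
      continuous_parametric_integral_of_continuous
        (f := fun (t : ℝ) (y : E3) ↦ W (E4.ofTimeSpace (t + F y) y) * p2 (E4.ofTimeSpace (t + F y) y))
        (hWp2c.comp hgraph2) (isCompact_closedBall _ _)
    have hXnn : ∀ t, 0 ≤ Xt t := fun t ↦
      setIntegral_nonneg measurableSet_closedBall fun y _ ↦ mul_nonneg (hW0 _) (hp2nn _)
    have hXi : ∀ t, IntegrableOn
        (fun y : E3 ↦ W (E4.ofTimeSpace (t + F y) y) * p2 (E4.ofTimeSpace (t + F y) y))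
        (closedBall (0 : E3) ρ) := fun t ↦
      (hWp2c.comp (hgraph t)).continuousOn.integrableOn_compact (isCompact_closedBall _ _)
    set Y : ℝ := ∫ u in Set.Ioc 0 s, Xt u with hY
    have hYnn : 0 ≤ Y := setIntegral_nonneg measurableSet_Ioc fun u _ ↦ hXnn u
    -- the weighted estimate of Part 5
    have hw : A * c * Xt s + A * Y ≤ C * Xt 0 + C * Z := by
      have h := hest F c hF hc hc1 hFc Φ hΦ hsolB ε hε s hs
      simpa only [hXt, hY, hZ, hZt, hW, hV, hp2, hχ] using h
    -- the real inequality `Xt s + Y ≤ (C + 1)/(A c) · (Xt 0 + Z)`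
    have hkey : Xt s + Y ≤ (C + 1) / (A * c) * (Xt 0 + Z) := by
      have hX0 := hXnn 0
      have hXs := hXnn s
      have h1 : A * c * Y ≤ A * Y := by
        have : A * c ≤ A := by nlinarith only [hA, hc1]
        exact mul_le_mul_of_nonneg_right this hYnn
      have h2 : C * Xt 0 + C * Z ≤ (C + 1) * (Xt 0 + Z) := by nlinarith only [hX0, hZnn']
      rw [div_mul_eq_mul_div, le_div_iff₀ (mul_pos hA hc)]
      nlinarith only [h1, h2, hw]
    -- (a) the leaf integrals from below: `W = 1` on `S n t ⊆ {‖y‖ ≤ ρ}`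
    have hSK : ∀ t y, y ∈ S n t → E4.ofTimeSpace (t + F y) y ∈ K := fun t y hy ↦ by
      rw [hmemS] at hy
      refine ⟨?_, hy.2.trans hR12.le⟩
      show ε ≤ horizonFn M a (E4.ofTimeSpace (t + F y) y)
      rw [hεdef]
      linarith [hy.1, hε.le]
    have hSball : ∀ t, S n t ⊆ closedBall (0 : E3) ρ := fun t y hy ↦ by
      rw [mem_closedBall, dist_zero_right]
      have h := spatialNorm_le_of_mem_redShiftWeightSet hrp hε (hSK t y hy)
      rwa [E4.spatialNorm_ofTimeSpace] at h
    have hW1S : ∀ t y, y ∈ S n t → W (E4.ofTimeSpace (t + F y) y) = 1 := fun t y hy ↦ by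
      rw [hmemS] at hy
      refine redShiftWeight_eq_one hR12 hε ?_ hy.2
      rw [hεdef]
      exact hy.1
    have hleaf : ∀ t, ∫⁻ y, (S n t).indicator (fd t) y ≤ ENNReal.ofReal (Xt t) := by
      intro t
      rw [lintegral_indicator (hSm n t)]
      calc ∫⁻ y in S n t, fd t y
          ≤ ∫⁻ y in S n t, ENNReal.ofReal
              (W (E4.ofTimeSpace (t + F y) y) * p2 (E4.ofTimeSpace (t + F y) y)) :=
            setLIntegral_mono' (hSm n t) fun y hy ↦ by
              rw [hW1S t y hy, one_mul]
        _ ≤ ∫⁻ y in closedBall (0 : E3) ρ, ENNReal.ofReal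
              (W (E4.ofTimeSpace (t + F y) y) * p2 (E4.ofTimeSpace (t + F y) y)) :=
            lintegral_mono_set (hSball t)
        _ = ENNReal.ofReal (Xt t) :=
            (ofReal_integral_eq_lintegral_ofReal (hXi t)
              (ae_of_all _ fun y ↦ mul_nonneg (hW0 _) (hp2nn _))).symm
    -- (b) the bulk from below
    have hbulk : ∫⁻ u in Set.Ioc 0 s, ∫⁻ y, (S n u).indicator (fd u) y ≤ ENNReal.ofReal Y := by
      calc ∫⁻ u in Set.Ioc 0 s, ∫⁻ y, (S n u).indicator (fd u) y
          ≤ ∫⁻ u in Set.Ioc 0 s, ENNReal.ofReal (Xt u) := lintegral_mono fun u ↦ hleaf u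
        _ = ENNReal.ofReal Y :=
            (ofReal_integral_eq_lintegral_ofReal
              (hXc.integrableOn_Icc.mono_set Set.Ioc_subset_Icc_self)
              (ae_of_all _ fun u ↦ hXnn u)).symm
    -- (c) the initial leaf integral from above: `W ≤ 1_{r₊ < r ≤ R₂}`
    have hinit : ENNReal.ofReal (Xt 0) ≤ E0 := by
      rw [show Xt 0 = ∫ y in closedBall (0 : E3) ρ,
          W (E4.ofTimeSpace (0 + F y) y) * p2 (E4.ofTimeSpace (0 + F y) y) from rfl,
        ofReal_integral_eq_lintegral_ofReal (hXi 0)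
          (ae_of_all _ fun y ↦ mul_nonneg (hW0 _) (hp2nn _))]
      calc ∫⁻ y in closedBall (0 : E3) ρ,
            ENNReal.ofReal (W (E4.ofTimeSpace (0 + F y) y) * p2 (E4.ofTimeSpace (0 + F y) y))
          ≤ ∫⁻ y in closedBall (0 : E3) ρ, (T R₂ 0).indicator (fd 0) y := by
            refine lintegral_mono fun y ↦ ?_
            by_cases hWy : W (E4.ofTimeSpace (0 + F y) y) = 0
            · rw [hWy, zero_mul, ENNReal.ofReal_zero]
              exact zero_le
            · have hmem : E4.ofTimeSpace (0 + F y) y ∈ K := hWK _ hWy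
              have hyT : y ∈ T R₂ 0 :=
                (hmemT R₂ 0 y).2 ⟨rPlus_lt_radius_of_mem_redShiftWeightSet hε hmem, hmem.2⟩
              rw [Set.indicator_of_mem hyT]
              refine ENNReal.ofReal_le_ofReal ?_
              calc W (E4.ofTimeSpace (0 + F y) y) * p2 (E4.ofTimeSpace (0 + F y) y)
                  ≤ 1 * p2 (E4.ofTimeSpace (0 + F y) y) :=
                    mul_le_mul_of_nonneg_right (hWle _) (hp2nn _)
                _ = p2 (E4.ofTimeSpace (0 + F y) y) := one_mul _
        _ ≤ E0 := setLIntegral_le_lintegral _ _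
    -- (d) assemble in `[0, ∞]`
    have hq0 : 0 < (C + 1) / (A * c) := div_pos hC1 (mul_pos hA hc)
    have hqC₆ : (C + 1) / (A * c) * (1 + 4 * L) = C₆ / c := by
      rw [hC₆]
      field_simp
    have hq4 : 0 ≤ (C + 1) / (A * c) * (4 * L) := mul_nonneg hq0.le (by positivity)
    have hqexp : (C + 1) / (A * c) * (1 + 4 * L) =
        (C + 1) / (A * c) + (C + 1) / (A * c) * (4 * L) := by ring
    have hr1 : (C + 1) / (A * c) ≤ C₆ / c := by
      rw [← hqC₆, hqexp]
      linarith only [hq4]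
    have hr2 : (C + 1) / (A * c) * (4 * L) ≤ C₆ / c := by
      rw [← hqC₆, hqexp]
      linarith only [hq0]
    calc (∫⁻ y, (S n s).indicator (fd s) y) + ∫⁻ u in Set.Ioc 0 s, ∫⁻ y, (S n u).indicator (fd u) y
        ≤ ENNReal.ofReal (Xt s) + ENNReal.ofReal Y := add_le_add (hleaf s) hbulk
      _ = ENNReal.ofReal (Xt s + Y) := (ENNReal.ofReal_add (hXnn s) hYnn).symm
      _ ≤ ENNReal.ofReal ((C + 1) / (A * c) * (Xt 0 + Z)) := ENNReal.ofReal_le_ofReal hkey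
      _ = ENNReal.ofReal ((C + 1) / (A * c)) * (ENNReal.ofReal (Xt 0) + ENNReal.ofReal Z) := by
          rw [ENNReal.ofReal_mul hq0.le, ENNReal.ofReal_add (hXnn 0) hZnn']
      _ ≤ ENNReal.ofReal ((C + 1) / (A * c)) * (E0 + ENNReal.ofReal (4 * L) * ShI) := by
          gcongr
      _ = ENNReal.ofReal ((C + 1) / (A * c)) * E0 +
            ENNReal.ofReal ((C + 1) / (A * c) * (4 * L)) * ShI := by
          rw [mul_add, ENNReal.ofReal_mul hq0.le, mul_assoc]
      _ ≤ ENNReal.ofReal (C₆ / c) * E0 + ENNReal.ofReal (C₆ / c) * ShI := by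
          gcongr
      _ = ENNReal.ofReal (C₆ / c) * (E0 + ShI) := (mul_add _ _ _).symm
  -- ### Step 2: exhaustion `n → ∞`
  have hSmono : ∀ t, Monotone fun n ↦ S n t := by
    intro t n m hnm y hy
    rw [hmemS] at hy ⊢
    have hcast : (n : ℝ) ≤ m := Nat.cast_le.mpr hnm
    refine ⟨le_trans ?_ hy.1, hy.2⟩
    have h1 : (0 : ℝ) < (n : ℝ) + 1 := by positivity
    gcongr
  have hUnion : ∀ t, T R₁ t = ⋃ n, S n t := by
    intro t
    ext y
    rw [Set.mem_iUnion, hmemT]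
    constructor
    · rintro ⟨hr, hR⟩
      set h : ℝ := horizonFn M a (E4.ofTimeSpace (t + F y) y) with hh
      have hpos : 0 < h := mul_pos (sub_pos.mpr hr) (Real.exp_pos _)
      obtain ⟨n, hn⟩ := exists_nat_ge (2 / h)
      refine ⟨n, (hmemS n t y).2 ⟨?_, hR⟩⟩
      have hn1 : (0 : ℝ) < (n : ℝ) + 1 := by positivity
      rw [div_le_iff₀ hpos] at hn
      rw [← hh, mul_one_div, div_le_iff₀ hn1]
      have hmul : h * ((n : ℝ) + 1) = (n : ℝ) * h + h := by ring
      rw [hmul]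
      linarith only [hn, hpos]
    · rintro ⟨n, hn⟩
      rw [hmemS] at hn
      have hpos : 0 < horizonFn M a (E4.ofTimeSpace (t + F y) y) :=
        lt_of_lt_of_le (by positivity) hn.1
      exact ⟨rPlus_lt_radius_of_horizonFn_pos hpos, hn.2⟩
  have hind : ∀ t y, (T R₁ t).indicator (fd t) y = ⨆ n, (S n t).indicator (fd t) y := fun t y ↦ by
    rw [hUnion t]
    exact Set.indicator_iUnion_apply rfl _ _ _
  have hmonof : ∀ t, Monotone fun n ↦ (S n t).indicator (fd t) := fun t n m hnm y ↦
    Set.indicator_le_indicator_of_subset (hSmono t hnm) (fun _ ↦ zero_le) y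
  have hleafsup : ∀ t, ∫⁻ y, (T R₁ t).indicator (fd t) y =
      ⨆ n, ∫⁻ y, (S n t).indicator (fd t) y := by
    intro t
    calc ∫⁻ y, (T R₁ t).indicator (fd t) y = ∫⁻ y, ⨆ n, (S n t).indicator (fd t) y :=
          lintegral_congr (hind t)
      _ = ⨆ n, ∫⁻ y, (S n t).indicator (fd t) y :=
          lintegral_iSup (fun n ↦ (hfm t).indicator (hSm n t)) (hmonof t)
  have hbulksup : ∫⁻ u in Set.Ioc 0 s, ∫⁻ y, (T R₁ u).indicator (fd u) y =
      ⨆ n, ∫⁻ u in Set.Ioc 0 s, ∫⁻ y, (S n u).indicator (fd u) y := by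
    calc ∫⁻ u in Set.Ioc 0 s, ∫⁻ y, (T R₁ u).indicator (fd u) y
        = ∫⁻ u in Set.Ioc 0 s, ⨆ n, ∫⁻ y, (S n u).indicator (fd u) y :=
          lintegral_congr fun u ↦ hleafsup u
      _ = ⨆ n, ∫⁻ u in Set.Ioc 0 s, ∫⁻ y, (S n u).indicator (fd u) y :=
          lintegral_iSup (fun n ↦ hGm n)
            (fun n m hnm u ↦ lintegral_mono fun y ↦ hmonof u hnm y)
  rw [hleafsup s, hbulksup, ENNReal.iSup_add_iSup_of_monotone]
  · exact iSup_le hstep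
  · exact fun n m hnm ↦ lintegral_mono fun y ↦ hmonof s hnm y
  · exact fun n m hnm ↦ lintegral_mono fun u ↦ lintegral_mono fun y ↦ hmonof u hnm y

end Kerr

end Literature.Geometry.Lorentzian
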